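import Literature.MathematicalPhysics.QuantumFieldTheory.Balaban1983to89.B3VertexTensorBounds
import Literature.MathematicalPhysics.QuantumFieldTheory.Balaban1983to89.HiggsCovariancePos
import Literature.MathematicalPhysics.QuantumFieldTheory.Balaban1983to89.B3Eq14AuxFunction
import Literature.MathematicalPhysics.QuantumFieldTheory.Balaban1983to89.B3Prop1

/-!
# `Balaban1983to89.B3Eq18VertexExpansion` — T. Bałaban, *(Higgs)₂,₃ quantum fields in a finite volume. III.
Renormalization*, Commun. Math. Phys. **88** (1983) 411–445 [Balaban1983Higgs3], p. 413 [PDF 3], the vertices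
**(1.6)–(1.11)** of the perturbation expansion AS ANALYTIC EXPRESSIONS on the concrete `HiggsLattice` carrier, and the
printed sentence *"These vertices come from an expansion of the original lattice action"* (p. 413, after (1.11)) as a
KERNEL THEOREM: the vertices (1.8)–(1.11) are, bond by bond and with the printed numerical factors, the `e′`-Taylor
coefficients of the covariant kinetic term `−½⟨φ′, (−Δ^η_{B̃ + e′g_kA′ + Ã})φ′⟩` of the action / of the exponent of (1.4),
with the small field `Ã` expanded by the basic expansion (I.3.14) of [Balaban1982Higgs1] up to the order `n̄` with the
remainder `R_{n̄+1}`; and p. 414 [PDF 4]: *"the vertices of (1.5) are given by (1.6)–(1.8), (1.10), (1.13), and (1.14)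
with n′ = 0 and B̃ = A^{(k)}"* for the kinetic term of the typed (1.4) (`B3Eq14AuxFunction.Data14`)

statement-level skeleton of published theorems with citation tags; proofs where landed; nothing here is a claim about
the Yang–Mills mass gap

PDFs held: `paper:balaban1983-higgs-2-3-quantum-fields-finite-volume` (journal page = PDF page + 410; pp. 412–414 read on
the ×2 renders `run/shared/lean/pub/pub-balaban/b2b-balaban-ref1/pages/1983-cmp88-higgs23-III/1983-cmp88-higgs23-III-p002…p004-x2.png`,
never from the OCR layer, which garbles every display of p. 413) and `paper:balaban1982-cmp85-higgs23-i`
(journal page = PDF page + 602; (1.7) p. 605, (3.14) p. 614).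

CITATION HEADER (lean-in-tree rule).  lit-balaban TYPED SKELETON (HOME `run/shared/lean/pub/lit-balaban/`), row
**B3.Eq1.6-1.11** (owner r15, `lit-balaban-r15/ROWS-B3.md`; head `typed p238938` = `B3Prop1.VertexKind`, which records the
vertices (1.6)–(1.11) at DATA level — numbers of legs, `η`-powers, coupling orders; the owner's cell: *"the analytic vertex
expressions are not modelled"*).  This module is a LOCATED MEMBER of that row (no head claim; cells are the owner's):
it models the analytic expressions and proves the expansion sentence.  Unit `lit-balaban-typer` gen 29
(literature-prover-lit-balaban-typer-g29-0), typer lineage of concrete (Higgs)₂,₃ carriers (`HiggsLattice` p239040,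
`HiggsCovariance`/`HiggsCovariancePos`, `B3Eq14AuxFunction` p250365).  Nothing of another seat is modified; the
remainder `R_{n̄+1}` is r15's `B3VertexTensorBounds.taylorRemOp` (its (I.3.14) `exp_eq_taylor_sum_add'` is the engine of §4).

THE SOURCE TEXT (p. 413 [PDF 3], displays read on the render; `η = L^{-k}`, `b₋` the initial point of the bond `b`,
`q` the antisymmetric charge matrix of (I.1.7), `e(L^kε)`, `λ(L^kε)` the running couplings):
*"Let us begin this description by writing down all the vertices. The first two describe self-interaction of scalar
fields:* `−λ(L^kε) Σ_{x∈Ω₁} η^d|φ′(x)|⁴`, *φ′(x) is a scalar field leg,* (1.6) `−½ Σ_{x∈Ω₁} η^d δm_i²(x)(L^kε)²|φ′(x)|²`,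
*δm_i²(x) is one of the renormalization mass counterterms.* (1.7) *The next group of vertices describes an interaction of
scalar and vector fields:* `(e(L^kε))^{n+n′} ((−1)^{n+n′}η^{n+n′−1}/(n!n′!)) Σ_b η^d[(D^η_B̃φ′)(b)·q^{n+n′}φ′(b₋)](g_kA′_b)^n(Ã_b)^{n′},
n, n′ ≦ n̄, n + n′ ≧ 1,` (1.8) *and the corresponding R-vertices*
`(e(L^kε))^{n+n̄+1} ((−1)^{n+n̄+1}η^{n+n̄}/(n!(n̄+1)!)) Σ_b η^d[(D^η_B̃φ′)(b)·q^{n+n̄+1}R_{n̄+1}(−ηqe(L^kε)Ã_b)φ′(b₋)](g_kA′_b)^n(Ã_b)^{n̄+1},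
n ≦ n̄.` (1.9) *Furthermore* `(e(L^kε))^{n+n′} (η^{n+n′−2}/(n!n′!)) Σ_b η^d[φ′(b₋)·q^{n+n′}φ′(b₋)](g_kA′_b)^n(Ã_b)^{n′},
n + n′ even, n, n′ ≦ n̄, n + n′ ≧ 2,` (1.10) *and the R-vertices*
`(e(L^kε))^{n+n̄+1} ((−1)^{n+n̄+1}η^{n+n̄−1}/(n!(n̄+1)!)) Σ_b η^d[φ′(b₋)·q^{n+n̄+1}R_{n̄+1}(−ηqe(L^kε)Ã_b)φ′(b₋)](g_kA′_b)^n(Ã_b)^{n̄+1}.` (1.11)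
*These vertices come from an expansion of the original lattice action."*; p. 412: *"Let us write the corresponding
expansion for the expressions in (1.5) with A^{(k)} replaced by Ã + B̃ and the expansion taken with respect to Ã"*;
p. 414: *"Let us notice that the vertices of (1.5) are given by (1.6)–(1.8), (1.10), (1.13), and (1.14) with n′ = 0 and
B̃ = A^{(k)}."*; [Balaban1982Higgs1] (1.7) p. 605: *"(D^ε_Aφ)(b) = ε^{−1}(U(A_b)φ(b₊) − φ(b₋))"*, *"U(A) = exp(qεeA)"*,
*"Antisymmetry of q implies U(A)^* = U(−A)"*; (3.14) p. 614: *"U(A) = exp(ηqe(L^kε)A) = 1 + Σ_{n=1}^{n̄}(1/n!)(ηqe(L^kε)A)^n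
+ (1/(n̄+1)!)(ηqe(L^kε)A)^{n̄+1}R_{n̄+1}(ηqe(L^kε)A)"*.

THE ARGUMENT (ours; one bond at a time, then summed — print gives no derivation).  Write `X = (D^η_B̃φ′)(b)`, `v = φ′(b₋)`,
`W = U(C_b)` for the perturbation `C = e′g_kA′ + Ã`.  Since `U` is a unitary one-parameter group,
`(D^η_{B̃+C}φ′)(b) = WX + η^{−1}(W − 1)v` and
`|D^η_{B̃+C}φ′(b)|² = |X|² + 2η^{−1}[X·(1 − U(−C_b))v] + 2η^{−2}[v·(1 − U(−C_b))v]`, with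
`U(−C_b) = exp(−ηe e′g_kA′_b q)·exp(−ηeÃ_b q)`.  The `e′`-derivatives of the first factor at `e′ = 0` are the powers
`(−ηe g_kA′_b q)^n`; the second factor is expanded by (I.3.14) to order `n̄`; multiplying out gives, for the coefficient of
`e′^n/n!`, exactly the bond-`b` summands of (1.8)_{n,n′} (`n′ ≦ n̄`), of the R-vertex (1.9)_n, of (1.10)_{n,n′} and of
(1.11)_n — the factor `(−1)^{n+n′}` of the no-derivative terms is invisible in print because `[v·q^{m}v] = 0` for odd `m`
(`q` antisymmetric), which is print's restriction *"n + n′ even"*; the `n + n′ = 0` terms cancel the constants, leaving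
`−½η^d|X|²` at order zero.

WHAT IS TYPED / PROVED (definitions with bodies + theorems; no `Prop` fact; axioms standard).  For an arbitrary level `k`
of a `HiggsLattice` family `P` (`η = P.mesh k`), charge datum `C` (`C.e` plays `e(L^kε)`), cut-off `g`, fields `B̃, A′, Ã`,
scalar field `φ′`:
* §1 `vertex16`, `vertex17` ((1.6), (1.7)), the leg brackets `leg18` `[(D^η_B̃φ′)(b)·Tφ′(b₋)]`, `leg110` `[φ′(b₋)·Tφ′(b₋)]`,
  the R-tensor `remTensor` `= R_{n̄+1}(−ηqe(L^kε)Ã_b)`, and `vertex18`, `vertex19`, `vertex110`, `vertex111` ((1.8)–(1.11)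
  with the printed factors verbatim, summed over a finite set `S` of bonds — print's `Σ_b`; negative `η`-exponents as
  integer powers);
* §2 `covDeriv_add_apply` (`D^η_{B̃+C}φ′(b) = U(C_b)D^η_B̃φ′(b) + η^{−1}(U(C_b) − 1)φ′(b₋)`, the bond form of (I.3.16)),
  `norm_sq_covDeriv_add` (the display above), `inner_qpow_self_of_odd` (`[v·q^m v] = 0`, `m` odd);
* §3 the kinetic density `kinBond … b e′ = −½η^d|(D^η_{B̃+e′g_kA′+Ã}φ′)(b)|²` is smooth in `e′` with all derivatives in
  closed form (`iteratedDeriv_kinBond`);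
* §4 **`taylorCoeff_kinBond`** — for every `n`, `n̄` and bond `b`:
  `(1/n!)∂ⁿ_{e′}|₀ kinBond = [n = 0]·(−½η^d|(D^η_B̃φ′)(b)|²) + Σ_{n′≦n̄, n+n′≧1}(1.8)_{n,n′} + (1.9)_n + Σ_{n′≦n̄, n+n′ even, ≧2}(1.10)_{n,n′} + (1.11)_n`
  (each vertex with `S = {b}`); **`taylorCoeff_kineticForm`** — the same for print's `Σ_b` over the bonds inside a region
  `Ω` (Neumann), i.e. for `−½⟨φ′, (−Δ^{η,N}_{B̃+e′g_kA′+Ã,Ω})φ′⟩` with `HiggsCovariance.covLaplacianN`;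
  **`taylorCoeff_kineticForm_noSmallField`** — at `Ã = 0` only (1.8)_{n,0} and (1.10)_{n,0} remain (p. 414, *"with n′ = 0"*);
* §5 the typed (1.4): for r15/typer's `B3Eq14AuxFunction.Data14`, the exponent of the density of (1.4) is
  `−½⟨φ′,(−Δ^η_{e′g_k𝒜+A^{(k)},Ω})φ′⟩ − ½m²(L^kε)²⟨φ′,φ′⟩ + λ′·(1.6) + (1.7)[δm²(e′,λ′,·)] − E₁` (`log_density14_eq`), and the
  `e′`-Taylor coefficients of its kinetic term are (1.8)_{n,0} + (1.10)_{n,0} at `B̃ = A^{(k)}`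
  (`taylorCoeff_density14_kinetic`, p. 414's sentence for the typed objects); (1.7) is additive in the counterterm
  (`vertex17_add`: *"one of the renormalization mass counterterms"*).
* §6 (v1.1, append-only, same unit; the row owner's precision (i)) DATA BRIDGE to the token of record
  `B3Prop1.VertexKind` (p238938): the analytic expressions are homogeneous of degree `scalarLegs` in `φ′`
  (`vertex16…vertex111_smul_field`), of degree `vectorLegs` in `A′` (`vertex18…vertex111_smul_fluct`), of degree
  `extVectorLegs` in `Ã` for the non-R vertices (`vertex18/110_smul_ext`); they factor as
  `e(L^kε)^{dv} · (sign/factorials) · Σ_b η^{etaCount d}·(legs)` (`vertex18…vertex111_eq_data`, `vertex16_eq_data`); print's side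
  conditions = `VertexKind.Admissible` = the index ranges of `taylorCoeff_kinBond` (`admissible18_iff`, `admissible110_iff`,
  `admissible19_111`); `diffCount_catalogue`.
* §7 (v1.2, append-only) LOCALIZATION p. 420 (*"For the vertices (1.6) and (1.7) we localize simply by representing Ω₁ as a
  sum of unit cubes of the η-lattice"*): `sum_region_eq_sum_blocks`, `vertex16_region`/`vertex17_region` ((1.6)/(1.7) over
  `Ω₁ = B^k(Λ)` = the sum over the unit cubes `B^k(y)`, `y ∈ Λ`), `vertex16…vertex111_union` (additivity over disjoint pieces).
HONEST SCOPE: action-level identities (what print's sentence says); NOT the statement that the `e′`-derivatives of the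
Gaussian integral `E_k` of (1.4) are expectations/cumulants of these vertices (the cases `n̄ = 1, 2` are the typer's
`B3Eq15ChargeDerivative`/`B3Eq15ChargeSecondOrder`), NOT the averaging vertices (1.12)–(1.15) (the `T^η`-factor of (1.4)),
and no estimate.  `n, n′ ≦ n̄` of (1.8)/(1.10): the `n′`-truncation is the (I.3.14) order (proved for every `n̄`); the
`n`-range is whatever orders of `∂/∂e′` one takes ((1.5) takes `α ≦ n̄`) — the coefficient identity holds for every `n`.
-/

open scoped BigOperators InnerProductSpace
open NormedSpace

namespace Literature.MathematicalPhysics.QuantumFieldTheory.Balaban1983to89.B3Eq18VertexExpansion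

open Literature.MathematicalPhysics.QuantumFieldTheory.Balaban1983to89.HiggsLattice
open Literature.MathematicalPhysics.QuantumFieldTheory.Balaban1983to89.HiggsCovariance (E covLaplacianN)
open Literature.MathematicalPhysics.QuantumFieldTheory.Balaban1983to89.HiggsCovariancePos
open Literature.MathematicalPhysics.QuantumFieldTheory.Balaban1983to89.B3VertexTensorBounds
  (taylorRemOp exp_eq_taylor_sum_add')

noncomputable section

variable {P : Params} {N k : ℕ}

/-- The algebra of bounded operators on `ℝ^N` in which `q`, `U(A) = exp(qηeA)` and `R_{n̄+1}` live ((I.1.7) p. 605).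
[cite: Balaban1982Higgs1, (1.7) p.605] -/
abbrev Op (N : ℕ) : Type := E N →L[ℝ] E N

/-! ## §1. The vertices (1.6)–(1.11) p. 413 as analytic expressions -/

section Vertices

variable (C : ChargeData N)

/-- The bond field `(g_kA′)_b = g_k(b₋)·A′_b` of (1.8)–(1.11) (the cut-off `g_k` of (1.4) multiplies the fluctuation
field; same convention as `B3Eq14AuxFunction.siteMul`, here at any level). [cite: Balaban1983Higgs3, (1.4) p.412] -/
def gmul (g : Site P k → ℝ) (A : VecField P k) : VecField P k := fun b => g b.src * A b

/-- Unfolding of `gmul`. [cite: Balaban1983Higgs3, (1.4) p.412] -/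
theorem gmul_apply (g : Site P k → ℝ) (A : VecField P k) (b : PBond P k) : gmul g A b = g b.src * A b := rfl

/-- **(1.6)** p. 413: `−λ(L^kε) Σ_{x∈Ω₁} η^d |φ′(x)|⁴` (*"φ′(x) is a scalar field leg"*), for the running coupling
`λ(L^kε) = lamRun`. [cite: Balaban1983Higgs3, (1.6) p.413] -/
def vertex16 (lamRun : ℝ) (Ω₁ : Finset (Site P k)) (φ : ScalarField P k N) : ℝ :=
  -(lamRun * ∑ x ∈ Ω₁, P.mesh k ^ P.d * ‖φ x‖ ^ 4)

/-- **(1.7)** p. 413: `−½ Σ_{x∈Ω₁} η^d δm_i²(x)(L^kε)²|φ′(x)|²`, *"δm_i²(x) is one of the renormalization mass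
counterterms"* (`dm2 = δm_i²`, `ell = L^kε`). [cite: Balaban1983Higgs3, (1.7) p.413] -/
def vertex17 (dm2 : Site P k → ℝ) (ell : ℝ) (Ω₁ : Finset (Site P k)) (φ : ScalarField P k N) : ℝ :=
  -(1 / 2 : ℝ) * ∑ x ∈ Ω₁, P.mesh k ^ P.d * dm2 x * ell ^ 2 * ‖φ x‖ ^ 2

/-- The leg bracket `[(D^η_B̃φ′)(b)·Tφ′(b₋)]` of (1.8)/(1.9) for a tensor `T` (`T = q^{n+n′}` in (1.8),
`T = q^{n+n̄+1}R_{n̄+1}(−ηqe(L^kε)Ã_b)` in (1.9)); `·` is the scalar product of `ℝ^N`. [cite: Balaban1983Higgs3, (1.8) p.413] -/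
def leg18 (B : VecField P k) (φ : ScalarField P k N) (T : Op N) (b : PBond P k) : ℝ :=
  ⟪covDeriv C B φ b, T (φ b.src)⟫_ℝ

/-- The leg bracket `[φ′(b₋)·Tφ′(b₋)]` of (1.10)/(1.11). [cite: Balaban1983Higgs3, (1.10) p.413] -/
def leg110 (φ : ScalarField P k N) (T : Op N) (b : PBond P k) : ℝ :=
  ⟪φ b.src, T (φ b.src)⟫_ℝ

/-- The remainder tensor `R_{n̄+1}(−ηqe(L^kε)Ã_b)` of the R-vertices (1.9)/(1.11): r15's operator remainder
`taylorRemOp n̄` (= `R_{n̄+1}` of (I.3.14)) at the matrix `−ηe(L^kε)Ã_b·q`. [cite: Balaban1983Higgs3, (1.9) p.413]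
[cite: Balaban1982Higgs1, (3.14) p.614] -/
def remTensor (nbar : ℕ) (At : VecField P k) (b : PBond P k) : Op N :=
  taylorRemOp nbar ((-(P.mesh k * C.e * At b)) • C.q)

/-- **(1.8)** p. 413: `(e(L^kε))^{n+n′}·((−1)^{n+n′}η^{n+n′−1}/(n!n′!))·Σ_{b∈S} η^d[(D^η_B̃φ′)(b)·q^{n+n′}φ′(b₋)](g_kA′_b)^n(Ã_b)^{n′}`
(`S` = the set of bonds summed over; meaningful for `n + n′ ≧ 1`). [cite: Balaban1983Higgs3, (1.8) p.413] -/
def vertex18 (g : Site P k → ℝ) (B A1 At : VecField P k) (φ : ScalarField P k N) (n n' : ℕ)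
    (S : Finset (PBond P k)) : ℝ :=
  C.e ^ (n + n') * ((-1 : ℝ) ^ (n + n') * P.mesh k ^ ((n + n' : ℤ) - 1) / ((n.factorial : ℝ) * n'.factorial))
    * ∑ b ∈ S, P.mesh k ^ P.d * leg18 C B φ (C.q ^ (n + n')) b * (g b.src * A1 b) ^ n * At b ^ n'

/-- **(1.9)** p. 413, the R-vertex of (1.8):
`(e(L^kε))^{n+n̄+1}·((−1)^{n+n̄+1}η^{n+n̄}/(n!(n̄+1)!))·Σ_{b∈S} η^d[(D^η_B̃φ′)(b)·q^{n+n̄+1}R_{n̄+1}(−ηqe(L^kε)Ã_b)φ′(b₋)](g_kA′_b)^n(Ã_b)^{n̄+1}`.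
[cite: Balaban1983Higgs3, (1.9) p.413] -/
def vertex19 (g : Site P k → ℝ) (B A1 At : VecField P k) (φ : ScalarField P k N) (nbar n : ℕ)
    (S : Finset (PBond P k)) : ℝ :=
  C.e ^ (n + nbar + 1)
      * ((-1 : ℝ) ^ (n + nbar + 1) * P.mesh k ^ (n + nbar) / ((n.factorial : ℝ) * (nbar + 1).factorial))
    * ∑ b ∈ S, P.mesh k ^ P.d * leg18 C B φ (C.q ^ (n + nbar + 1) * remTensor C nbar At b) b
        * (g b.src * A1 b) ^ n * At b ^ (nbar + 1)

/-- **(1.10)** p. 413: `(e(L^kε))^{n+n′}·(η^{n+n′−2}/(n!n′!))·Σ_{b∈S} η^d[φ′(b₋)·q^{n+n′}φ′(b₋)](g_kA′_b)^n(Ã_b)^{n′}`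
(meaningful for `n + n′` even, `≧ 2`). [cite: Balaban1983Higgs3, (1.10) p.413] -/
def vertex110 (g : Site P k → ℝ) (A1 At : VecField P k) (φ : ScalarField P k N) (n n' : ℕ)
    (S : Finset (PBond P k)) : ℝ :=
  C.e ^ (n + n') * (P.mesh k ^ ((n + n' : ℤ) - 2) / ((n.factorial : ℝ) * n'.factorial))
    * ∑ b ∈ S, P.mesh k ^ P.d * leg110 φ (C.q ^ (n + n')) b * (g b.src * A1 b) ^ n * At b ^ n'

/-- **(1.11)** p. 413, the R-vertex of (1.10):
`(e(L^kε))^{n+n̄+1}·((−1)^{n+n̄+1}η^{n+n̄−1}/(n!(n̄+1)!))·Σ_{b∈S} η^d[φ′(b₋)·q^{n+n̄+1}R_{n̄+1}(−ηqe(L^kε)Ã_b)φ′(b₋)](g_kA′_b)^n(Ã_b)^{n̄+1}`.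
[cite: Balaban1983Higgs3, (1.11) p.413] -/
def vertex111 (g : Site P k → ℝ) (A1 At : VecField P k) (φ : ScalarField P k N) (nbar n : ℕ)
    (S : Finset (PBond P k)) : ℝ :=
  C.e ^ (n + nbar + 1)
      * ((-1 : ℝ) ^ (n + nbar + 1) * P.mesh k ^ ((n + nbar : ℤ) - 1) / ((n.factorial : ℝ) * (nbar + 1).factorial))
    * ∑ b ∈ S, P.mesh k ^ P.d * leg110 φ (C.q ^ (n + nbar + 1) * remTensor C nbar At b) b
        * (g b.src * A1 b) ^ n * At b ^ (nbar + 1)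

/-- (1.7) is additive in the counterterm: the mass-counterterm term of (1.4) with `δm² = Σ_i δm_i²` ((1.29)) is the sum of
the vertices (1.7) of the pieces (*"δm_i²(x) is one of the renormalization mass counterterms"*). [cite: Balaban1983Higgs3, (1.7) p.413] -/
theorem vertex17_add (f₁ f₂ : Site P k → ℝ) (ell : ℝ) (Ω₁ : Finset (Site P k)) (φ : ScalarField P k N) :
    vertex17 (f₁ + f₂) ell Ω₁ φ = vertex17 f₁ ell Ω₁ φ + vertex17 f₂ ell Ω₁ φ := by
  unfold vertex17
  rw [← mul_add, ← Finset.sum_add_distrib]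
  congr 1
  refine Finset.sum_congr rfl fun x _ => ?_
  rw [Pi.add_apply]
  ring

/-- (1.7) for a finite family of counterterm pieces. [cite: Balaban1983Higgs3, (1.7) p.413] -/
theorem vertex17_sum {ι : Type*} (s : Finset ι) (f : ι → Site P k → ℝ) (ell : ℝ) (Ω₁ : Finset (Site P k))
    (φ : ScalarField P k N) :
    vertex17 (∑ i ∈ s, f i) ell Ω₁ φ = ∑ i ∈ s, vertex17 (f i) ell Ω₁ φ := by
  classical
  induction s using Finset.induction_on with
  | empty =>
      unfold vertex17
      simp
  | insert i s hi ih => rw [Finset.sum_insert hi, Finset.sum_insert hi, vertex17_add, ih]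

/-- The vertices are sums over the bonds: `(1.8)` over `S` is the sum of `(1.8)` over the singletons `{b}`, `b ∈ S`
(print's `Σ_b`). [cite: Balaban1983Higgs3, (1.8) p.413] -/
theorem vertex18_eq_sum (g : Site P k → ℝ) (B A1 At : VecField P k) (φ : ScalarField P k N) (n n' : ℕ)
    (S : Finset (PBond P k)) :
    vertex18 C g B A1 At φ n n' S = ∑ b ∈ S, vertex18 C g B A1 At φ n n' {b} := by
  unfold vertex18
  rw [Finset.mul_sum]
  refine Finset.sum_congr rfl fun b _ => ?_
  rw [Finset.sum_singleton]

/-- (1.9) over `S` is the sum over the singletons. [cite: Balaban1983Higgs3, (1.9) p.413] -/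
theorem vertex19_eq_sum (g : Site P k → ℝ) (B A1 At : VecField P k) (φ : ScalarField P k N) (nbar n : ℕ)
    (S : Finset (PBond P k)) :
    vertex19 C g B A1 At φ nbar n S = ∑ b ∈ S, vertex19 C g B A1 At φ nbar n {b} := by
  unfold vertex19
  rw [Finset.mul_sum]
  refine Finset.sum_congr rfl fun b _ => ?_
  rw [Finset.sum_singleton]

/-- (1.10) over `S` is the sum over the singletons. [cite: Balaban1983Higgs3, (1.10) p.413] -/
theorem vertex110_eq_sum (g : Site P k → ℝ) (A1 At : VecField P k) (φ : ScalarField P k N) (n n' : ℕ)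
    (S : Finset (PBond P k)) :
    vertex110 C g A1 At φ n n' S = ∑ b ∈ S, vertex110 C g A1 At φ n n' {b} := by
  unfold vertex110
  rw [Finset.mul_sum]
  refine Finset.sum_congr rfl fun b _ => ?_
  rw [Finset.sum_singleton]

/-- (1.11) over `S` is the sum over the singletons. [cite: Balaban1983Higgs3, (1.11) p.413] -/
theorem vertex111_eq_sum (g : Site P k → ℝ) (A1 At : VecField P k) (φ : ScalarField P k N) (nbar n : ℕ)
    (S : Finset (PBond P k)) :
    vertex111 C g A1 At φ nbar n S = ∑ b ∈ S, vertex111 C g A1 At φ nbar n {b} := by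
  unfold vertex111
  rw [Finset.mul_sum]
  refine Finset.sum_congr rfl fun b _ => ?_
  rw [Finset.sum_singleton]

end Vertices

/-! ## §2. One bond: the covariant derivative at `B̃ + C` and the square of its length -/

section Bond

variable (C : ChargeData N)

/-- **`(D^η_{B̃+C}φ′)(b) = U(C_b)(D^η_B̃φ′)(b) + η^{−1}(U(C_b) − 1)φ′(b₋)`** — the bond form of the expansion (I.3.16)
of the covariant derivative (`U(B̃_b + C_b) = U(C_b)U(B̃_b)`, `U` a one-parameter group, (I.1.7); `U(C) − 1 = F′_{1,k}(C)`
of (I.3.14)). [cite: Balaban1982Higgs1, (3.16) p.615] -/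
theorem covDeriv_add_apply (B A : VecField P k) (φ : ScalarField P k N) (b : PBond P k) :
    covDeriv C (B + A) φ b
      = C.U (P.mesh k) (A b) (covDeriv C B φ b)
        + (P.mesh k)⁻¹ • (C.U (P.mesh k) (A b) (φ b.src) - φ b.src) := by
  simp only [covDeriv, Pi.add_apply]
  rw [add_comm (B b) (A b), C.U_add]
  rw [show (C.U (P.mesh k) (A b) * C.U (P.mesh k) (B b)) (φ b.tgt)
      = C.U (P.mesh k) (A b) (C.U (P.mesh k) (B b) (φ b.tgt)) from rfl]
  rw [map_smul, map_sub, smul_sub, smul_sub, smul_sub]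
  abel

/-- `⟨U(a)x, y⟩ = ⟨x, U(−a)y⟩` (*"U(A)^* = U(−A)"*, (I.1.7) p. 605). [cite: Balaban1982Higgs1, (1.7) p.605] -/
theorem inner_U_left (η a : ℝ) (x y : E N) : ⟪C.U η a x, y⟫_ℝ = ⟪x, C.U η (-a) y⟫_ℝ := by
  rw [← C.star_U, inner_star_U]

/-- **`|D^η_{B̃+C}φ′(b)|² = |X|² + 2η^{−1}[X·(1 − U(−C_b))v] + 2η^{−2}[v·(1 − U(−C_b))v]`**, `X = (D^η_B̃φ′)(b)`,
`v = φ′(b₋)` (unitarity of `U`). [cite: Balaban1983Higgs3, (1.8)–(1.11) p.413] -/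
theorem norm_sq_covDeriv_add (B A : VecField P k) (φ : ScalarField P k N) (b : PBond P k) :
    ‖covDeriv C (B + A) φ b‖ ^ 2
      = ‖covDeriv C B φ b‖ ^ 2
        + 2 * (P.mesh k)⁻¹
            * (⟪covDeriv C B φ b, φ b.src⟫_ℝ - ⟪covDeriv C B φ b, C.U (P.mesh k) (-(A b)) (φ b.src)⟫_ℝ)
        + 2 * (P.mesh k)⁻¹ ^ 2 * (‖φ b.src‖ ^ 2 - ⟪φ b.src, C.U (P.mesh k) (-(A b)) (φ b.src)⟫_ℝ) := by
  rw [covDeriv_add_apply]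
  have hU1 : ∀ x : E N, ‖C.U (P.mesh k) (A b) x‖ ^ 2 = ‖x‖ ^ 2 := fun x => by
    rw [← real_inner_self_eq_norm_sq, inner_U_U, real_inner_self_eq_norm_sq]
  rw [norm_add_sq_real, hU1, real_inner_smul_right, inner_sub_right, inner_U_U, inner_U_left, norm_smul, mul_pow,
    Real.norm_eq_abs, sq_abs, norm_sub_sq_real, hU1, inner_U_left]
  ring

/-- `[v·q^m v] = 0` for odd `m`: `q^m` is antisymmetric (`q^* = −q`, (I.1.7)) — why (1.10) carries only
*"n + n′ even"*. [cite: Balaban1983Higgs3, (1.10) p.413] [cite: Balaban1982Higgs1, (1.7) p.605] -/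
theorem inner_qpow_self_of_odd {m : ℕ} (hm : Odd m) (v : E N) : ⟪v, (C.q ^ m) v⟫_ℝ = 0 := by
  have hs : star (C.q ^ m) = -(C.q ^ m) := by
    rw [star_pow, C.q_skew]; exact hm.neg_pow C.q
  have h1 : ⟪v, (C.q ^ m) v⟫_ℝ = ⟪(star (C.q ^ m)) v, v⟫_ℝ := by
    rw [ContinuousLinearMap.star_eq_adjoint, ContinuousLinearMap.adjoint_inner_left]
  rw [hs] at h1
  have h2 : (-(C.q ^ m)) v = -((C.q ^ m) v) := rfl
  rw [h2, inner_neg_left] at h1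
  have h3 := real_inner_comm v ((C.q ^ m) v)
  linarith

/-- For odd `n + n′` the leg bracket of (1.10) vanishes. [cite: Balaban1983Higgs3, (1.10) p.413] -/
theorem leg110_qpow_of_odd {m : ℕ} (hm : Odd m) (φ : ScalarField P k N) (b : PBond P k) :
    leg110 φ (C.q ^ m) b = 0 :=
  inner_qpow_self_of_odd C hm (φ b.src)

end Bond

/-! ## §3. The kinetic density of one bond at `B̃ + e′g_kA′ + Ã` and its `e′`-derivatives -/

section Kinetic

variable (C : ChargeData N) (g : Site P k → ℝ) (B A1 At : VecField P k) (φ : ScalarField P k N) (b : PBond P k)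

/-- The kinetic density of the bond `b` at the field `B̃ + e′·g_kA′ + Ã`, as a function of `e′`:
`e′ ↦ −½ η^d |(D^η_{B̃+e′g_kA′+Ã}φ′)(b)|²` (the bond-`b` summand of `−½⟨φ′,(−Δ^η_{(·)})φ′⟩` of (1.4)/(I.1.11)).
[cite: Balaban1983Higgs3, (1.4) p.412] -/
def kinBond (s : ℝ) : ℝ :=
  -(1 / 2 : ℝ) * P.mesh k ^ P.d * ‖covDeriv C (B + (s • gmul g A1 + At)) φ b‖ ^ 2

/-- The matrix `Y_b = −ηe(L^kε)(g_kA′)_b·q` — the `e′`-generator: `U(−e′(g_kA′)_b) = exp(e′Y_b)`. [cite: Balaban1983Higgs3, (1.8) p.413] -/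
def opY : Op N := (-(P.mesh k * C.e * (g b.src * A1 b))) • C.q

/-- The matrix `Z_b = −ηe(L^kε)Ã_b·q`: `U(−Ã_b) = exp(Z_b)`, the argument of `R_{n̄+1}` in (1.9)/(1.11). [cite: Balaban1983Higgs3, (1.9) p.413] -/
def opZ : Op N := (-(P.mesh k * C.e * At b)) • C.q

/-- `U(−(e′g_kA′ + Ã)_b) = exp(e′Y_b)·exp(Z_b)` (`U` is a one-parameter group, (I.1.7)). [cite: Balaban1982Higgs1, (1.7) p.605] -/
theorem U_neg_pert (s : ℝ) :
    C.U (P.mesh k) (-((s • gmul g A1 + At) b)) = exp (s • opY C g A1 b) * exp (opZ C At b) := by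
  have hb : (s • gmul g A1 + At) b = s * (g b.src * A1 b) + At b := by
    simp [gmul, Pi.add_apply, Pi.smul_apply, smul_eq_mul]
  rw [hb, neg_add, C.U_add]
  unfold ChargeData.U opY opZ
  congr 1
  · rw [smul_smul]
    congr 1
    congr 1
    ring
  · congr 1
    congr 1
    ring

/-- The `e′`-independent part of the bond density after the splitting of §2:
`−½η^d|X|² − η^{d−1}[X·v] − η^{d−2}|v|²`. [cite: Balaban1983Higgs3, (1.8)–(1.11) p.413] -/
def kinConst : ℝ :=
  -(1 / 2 : ℝ) * P.mesh k ^ P.d * ‖covDeriv C B φ b‖ ^ 2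
    - P.mesh k ^ P.d * (P.mesh k)⁻¹ * ⟪covDeriv C B φ b, φ b.src⟫_ℝ
    - P.mesh k ^ P.d * (P.mesh k)⁻¹ ^ 2 * ‖φ b.src‖ ^ 2

/-- The `n`-th `e′`-derivative of the bond density in closed form:
`[n=0]·const + η^{d−1}[X·Y_b^n exp(e′Y_b)exp(Z_b)v] + η^{d−2}[v·Y_b^n exp(e′Y_b)exp(Z_b)v]`. [cite: Balaban1983Higgs3, (1.8)–(1.11) p.413] -/
def kinDeriv (n : ℕ) (s : ℝ) : ℝ :=
  (if n = 0 then kinConst C B φ b else 0)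
    + P.mesh k ^ P.d * (P.mesh k)⁻¹
        * ⟪covDeriv C B φ b, (opY C g A1 b ^ n * (exp (s • opY C g A1 b) * exp (opZ C At b))) (φ b.src)⟫_ℝ
    + P.mesh k ^ P.d * (P.mesh k)⁻¹ ^ 2
        * ⟪φ b.src, (opY C g A1 b ^ n * (exp (s • opY C g A1 b) * exp (opZ C At b))) (φ b.src)⟫_ℝ

/-- The bond density IS `kinDeriv 0` (§2 and `U(−C_b) = exp(e′Y_b)exp(Z_b)`). [cite: Balaban1983Higgs3, (1.8)–(1.11) p.413] -/
theorem kinBond_eq_kinDeriv_zero : kinBond C g B A1 At φ b = kinDeriv C g B A1 At φ b 0 := by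
  funext s
  unfold kinBond kinDeriv kinConst
  rw [norm_sq_covDeriv_add, U_neg_pert]
  simp only [if_true, pow_zero, one_mul]
  ring

/-- The functional `T ↦ [x·Tv]` on the operator algebra (continuous linear). [folklore] -/
def ell (x v : E N) : Op N →L[ℝ] ℝ := (innerSL ℝ x).comp (ContinuousLinearMap.apply ℝ (E N) v)

/-- Unfolding of `ell`. [folklore] -/
private theorem ell_apply (x v : E N) (T : Op N) : ell x v T = ⟪x, T v⟫_ℝ := rfl

/-- Mathlib's `IsScalarTower.right` for the operator algebra, in the form instance search expects for the
operator-norm scalar action. [folklore] -/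
private theorem clm_isScalarTower : IsScalarTower ℝ (Op N) (Op N) := IsScalarTower.right (R := ℝ) (A := Op N)

/-- Companion of `clm_isScalarTower` (Mathlib's `Algebra.to_smulCommClass`). [folklore] -/
private theorem clm_smulCommClass : SMulCommClass ℝ (Op N) (Op N) := Algebra.to_smulCommClass (R := ℝ) (A := Op N)

/-- `d/de′ [x·Yⁿexp(e′Y)Ev] = [x·Y^{n+1}exp(e′Y)Ev]` (Mathlib: `d/dt exp(tY) = Y exp(tY)`). [folklore] -/
private theorem hasDerivAt_inner_pow_mul_exp (x v : E N) (Y T : Op N) (n : ℕ) (s : ℝ) :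
    HasDerivAt (fun s : ℝ => ⟪x, (Y ^ n * (exp (s • Y) * T)) v⟫_ℝ)
      (⟪x, (Y ^ (n + 1) * (exp (s • Y) * T)) v⟫_ℝ) s := by
  haveI := clm_isScalarTower (N := N); haveI := clm_smulCommClass (N := N)
  have h1 : HasDerivAt (fun s : ℝ => exp (s • Y)) (Y * exp (s • Y)) s := hasDerivAt_exp_smul_const' (𝕂 := ℝ) Y s
  let M : Op N →L[ℝ] Op N :=
    (ContinuousLinearMap.mul ℝ (Op N) (Y ^ n)).comp ((ContinuousLinearMap.mul ℝ (Op N)).flip T)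
  have hM : ∀ S, M S = Y ^ n * (S * T) := fun S => by simp [M]
  have h2 : HasDerivAt (fun s : ℝ => M (exp (s • Y))) (M (Y * exp (s • Y))) s := M.hasFDerivAt.comp_hasDerivAt s h1
  have h3 : HasDerivAt (fun s : ℝ => ell x v (M (exp (s • Y)))) (ell x v (M (Y * exp (s • Y)))) s :=
    (ell x v).hasFDerivAt.comp_hasDerivAt s h2
  have h4 : ∀ S, ell x v (M S) = ⟪x, (Y ^ n * (S * T)) v⟫_ℝ := fun S => by rw [ell_apply, hM]
  simp only [h4] at h3
  convert h3 using 2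
  rw [pow_succ, mul_assoc, mul_assoc]

/-- `d/de′ kinDeriv n = kinDeriv (n+1)`. [cite: Balaban1983Higgs3, (1.8)–(1.11) p.413] -/
theorem hasDerivAt_kinDeriv (n : ℕ) (s : ℝ) :
    HasDerivAt (kinDeriv C g B A1 At φ b n) (kinDeriv C g B A1 At φ b (n + 1) s) s := by
  have h1 := hasDerivAt_inner_pow_mul_exp (covDeriv C B φ b) (φ b.src) (opY C g A1 b) (exp (opZ C At b)) n s
  have h2 := hasDerivAt_inner_pow_mul_exp (φ b.src) (φ b.src) (opY C g A1 b) (exp (opZ C At b)) n s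
  have h : HasDerivAt (fun s : ℝ => (if n = 0 then kinConst C B φ b else 0)
      + P.mesh k ^ P.d * (P.mesh k)⁻¹
          * ⟪covDeriv C B φ b, (opY C g A1 b ^ n * (exp (s • opY C g A1 b) * exp (opZ C At b))) (φ b.src)⟫_ℝ
      + P.mesh k ^ P.d * (P.mesh k)⁻¹ ^ 2
          * ⟪φ b.src, (opY C g A1 b ^ n * (exp (s • opY C g A1 b) * exp (opZ C At b))) (φ b.src)⟫_ℝ)
      (0 + P.mesh k ^ P.d * (P.mesh k)⁻¹
          * ⟪covDeriv C B φ b, (opY C g A1 b ^ (n + 1) * (exp (s • opY C g A1 b) * exp (opZ C At b))) (φ b.src)⟫_ℝ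
        + P.mesh k ^ P.d * (P.mesh k)⁻¹ ^ 2
          * ⟪φ b.src, (opY C g A1 b ^ (n + 1) * (exp (s • opY C g A1 b) * exp (opZ C At b))) (φ b.src)⟫_ℝ) s :=
    ((hasDerivAt_const s _).add (h1.const_mul _)).add (h2.const_mul _)
  have hz : kinDeriv C g B A1 At φ b (n + 1) s
      = 0 + P.mesh k ^ P.d * (P.mesh k)⁻¹
          * ⟪covDeriv C B φ b, (opY C g A1 b ^ (n + 1) * (exp (s • opY C g A1 b) * exp (opZ C At b))) (φ b.src)⟫_ℝ
        + P.mesh k ^ P.d * (P.mesh k)⁻¹ ^ 2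
          * ⟪φ b.src, (opY C g A1 b ^ (n + 1) * (exp (s • opY C g A1 b) * exp (opZ C At b))) (φ b.src)⟫_ℝ := by
    unfold kinDeriv
    rw [if_neg (Nat.succ_ne_zero n)]
  rw [hz]
  exact h

/-- From a derivative chain to all iterated derivatives. [folklore] -/
private theorem iteratedDeriv_eq_of_hasDerivAt_succ (f : ℕ → ℝ → ℝ) (hf : ∀ n s, HasDerivAt (f n) (f (n + 1) s) s)
    (n : ℕ) : iteratedDeriv n (f 0) = f n := by
  induction n with
  | zero => exact iteratedDeriv_zero
  | succ n ih =>
      rw [iteratedDeriv_succ, ih]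
      funext s
      exact (hf n s).deriv

/-- **All `e′`-derivatives of the bond density in closed form**: `∂ⁿ_{e′} kinBond = kinDeriv n`. [cite: Balaban1983Higgs3, (1.8)–(1.11) p.413] -/
theorem iteratedDeriv_kinBond (n : ℕ) : iteratedDeriv n (kinBond C g B A1 At φ b) = kinDeriv C g B A1 At φ b n := by
  rw [kinBond_eq_kinDeriv_zero]
  exact iteratedDeriv_eq_of_hasDerivAt_succ _ (hasDerivAt_kinDeriv C g B A1 At φ b) n

/-- The bond density is smooth in `e′`. [cite: Balaban1983Higgs3, (1.5) p.412] -/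
theorem contDiff_kinBond {m : ℕ∞} : ContDiff ℝ m (kinBond C g B A1 At φ b) := by
  rw [kinBond_eq_kinDeriv_zero]
  refine contDiff_of_differentiable_iteratedDeriv fun n _ => ?_
  rw [iteratedDeriv_eq_of_hasDerivAt_succ _ (hasDerivAt_kinDeriv C g B A1 At φ b) n]
  exact fun s => (hasDerivAt_kinDeriv C g B A1 At φ b n s).differentiableAt

end Kinetic

/-! ## §4. *"These vertices come from an expansion of the original lattice action"* -/

section Expansion

variable (C : ChargeData N) (g : Site P k → ℝ) (B A1 At : VecField P k) (φ : ScalarField P k N)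

/-- `Y_bⁿ·exp(Z_b)` multiplied out against (I.3.14) for `exp(Z_b)` to order `n̄`:
`Σ_{m≦n̄} (m!)^{−1} y^n z^m q^{n+m} + ((n̄+1)!)^{−1} y^n z^{n̄+1} q^{n+n̄+1}R_{n̄+1}(zq)` (`y = −ηe(g_kA′)_b`, `z = −ηeÃ_b`).
[cite: Balaban1982Higgs1, (3.14) p.614] -/
theorem opY_pow_mul_exp_opZ (nbar n : ℕ) (b : PBond P k) :
    opY C g A1 b ^ n * exp (opZ C At b)
      = ∑ m ∈ Finset.range (nbar + 1),
          (((m.factorial : ℝ)⁻¹)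
              * ((-(P.mesh k * C.e * (g b.src * A1 b))) ^ n * (-(P.mesh k * C.e * At b)) ^ m)) • C.q ^ (n + m)
        + ((((nbar + 1).factorial : ℝ)⁻¹)
              * ((-(P.mesh k * C.e * (g b.src * A1 b))) ^ n * (-(P.mesh k * C.e * At b)) ^ (nbar + 1)))
            • (C.q ^ (n + nbar + 1) * remTensor C nbar At b) := by
  haveI := clm_isScalarTower (N := N); haveI := clm_smulCommClass (N := N)
  unfold opY opZ remTensor
  rw [exp_eq_taylor_sum_add' nbar ((-(P.mesh k * C.e * At b)) • C.q), mul_add, Finset.mul_sum]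
  congr 1
  · refine Finset.sum_congr rfl fun m _ => ?_
    rw [mul_smul_comm, smul_pow, smul_pow, smul_mul_smul_comm, ← pow_add, smul_smul]
  · rw [mul_smul_comm, smul_pow, smul_pow, ← mul_assoc, smul_mul_smul_comm, ← pow_add, smul_mul_assoc, smul_smul,
      show n + (nbar + 1) = n + nbar + 1 from (add_assoc n nbar 1).symm]

/-- The same after pairing with `[x·(·)v]`. [cite: Balaban1982Higgs1, (3.14) p.614] -/
theorem inner_opY_pow_mul_exp_opZ (nbar n : ℕ) (b : PBond P k) (x v : E N) :
    ⟪x, (opY C g A1 b ^ n * exp (opZ C At b)) v⟫_ℝ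
      = ∑ m ∈ Finset.range (nbar + 1),
          (((m.factorial : ℝ)⁻¹)
              * ((-(P.mesh k * C.e * (g b.src * A1 b))) ^ n * (-(P.mesh k * C.e * At b)) ^ m))
            * ⟪x, (C.q ^ (n + m)) v⟫_ℝ
        + ((((nbar + 1).factorial : ℝ)⁻¹)
              * ((-(P.mesh k * C.e * (g b.src * A1 b))) ^ n * (-(P.mesh k * C.e * At b)) ^ (nbar + 1)))
            * ⟪x, (C.q ^ (n + nbar + 1) * remTensor C nbar At b) v⟫_ℝ := by
  rw [opY_pow_mul_exp_opZ C g A1 At nbar n b, ← ell_apply, map_add, map_sum]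
  simp only [map_smul, smul_eq_mul, ell_apply]

/-- Finite-sum bookkeeping: split off the `n + m = 0` term. [folklore] -/
private theorem sum_range_split_pos (f : ℕ → ℝ) (n nbar : ℕ) :
    ∑ m ∈ Finset.range (nbar + 1), f m
      = (if n = 0 then f 0 else 0) + ∑ m ∈ (Finset.range (nbar + 1)).filter (fun m => 1 ≤ n + m), f m := by
  rw [Finset.sum_filter]
  rcases Nat.eq_zero_or_pos n with h | h
  · subst h
    rw [if_pos rfl, Finset.sum_range_succ' (fun m => if 1 ≤ 0 + m then f m else 0), Finset.sum_range_succ' f]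
    have h0 : (if 1 ≤ 0 + 0 then f 0 else 0) = 0 := if_neg (by omega)
    have h1 : ∀ m : ℕ, (if 1 ≤ 0 + (m + 1) then f (m + 1) else 0) = f (m + 1) := fun m => if_pos (by omega)
    simp only [h0, h1, add_zero]
    exact add_comm _ _
  · rw [if_neg (by omega), zero_add]
    exact Finset.sum_congr rfl fun m _ => (if_pos (by omega)).symm

/-- Finite-sum bookkeeping with parity: terms with `n + m` odd vanish. [folklore] -/
private theorem sum_range_split_even (f : ℕ → ℝ) (n nbar : ℕ) (hodd : ∀ m, Odd (n + m) → f m = 0) :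
    ∑ m ∈ Finset.range (nbar + 1), f m
      = (if n = 0 then f 0 else 0)
        + ∑ m ∈ (Finset.range (nbar + 1)).filter (fun m => Even (n + m) ∧ 2 ≤ n + m), f m := by
  rw [Finset.sum_filter]
  have hpt : ∀ m, f m = (if n + m = 0 then f m else 0) + (if Even (n + m) ∧ 2 ≤ n + m then f m else 0) := by
    intro m
    by_cases h0 : n + m = 0
    · rw [if_pos h0, if_neg (by omega), add_zero]
    · rw [if_neg h0, zero_add]
      rcases Nat.even_or_odd (n + m) with he | ho
      · rw [if_pos ⟨he, by obtain ⟨r, hr⟩ := he; omega⟩]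
      · rw [hodd m ho, if_neg (fun h => (Nat.not_even_iff_odd.mpr ho) h.1)]
  conv_lhs => rw [Finset.sum_congr rfl fun m _ => hpt m]
  rw [Finset.sum_add_distrib]
  congr 1
  rcases Nat.eq_zero_or_pos n with h | h
  · subst h
    rw [if_pos rfl, Finset.sum_range_succ' (fun m => if 0 + m = 0 then f m else 0)]
    have h0 : (if 0 + 0 = 0 then f 0 else 0) = f 0 := if_pos (Nat.zero_add 0)
    have h1 : ∀ m : ℕ, (if 0 + (m + 1) = 0 then f (m + 1) else 0) = 0 := fun m => if_neg (by omega)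
    rw [h0, Finset.sum_eq_zero (fun m _ => h1 m), zero_add]
  · rw [if_neg (by omega)]
    exact Finset.sum_eq_zero fun m _ => if_neg (by omega)

/-- Integer-power bookkeeping: `η^{m−1} = η^m·η^{−1}`. [folklore] -/
private theorem zpow_sub_one_nat {η : ℝ} (hη : η ≠ 0) (m : ℕ) : η ^ ((m : ℤ) - 1) = η ^ m * η⁻¹ := by
  rw [zpow_sub_one₀ hη, zpow_natCast]

/-- Integer-power bookkeeping: `η^{m−2} = η^m·η^{−2}`. [folklore] -/
private theorem zpow_sub_two_nat {η : ℝ} (hη : η ≠ 0) (m : ℕ) : η ^ ((m : ℤ) - 2) = η ^ m * η⁻¹ * η⁻¹ := by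
  rw [show ((m : ℤ) - 2) = ((m : ℤ) - 1) - 1 by ring, zpow_sub_one₀ hη, zpow_sub_one₀ hη, zpow_natCast]

/-- **p. 413: *"These vertices come from an expansion of the original lattice action"* — ONE BOND.**  For every order
`n` of `∂/∂e′`, every truncation order `n̄` of (I.3.14) in `Ã`, every bond `b` and all fields:
`(1/n!)·∂ⁿ_{e′}|_{e′=0}(−½η^d|(D^η_{B̃+e′g_kA′+Ã}φ′)(b)|²)
 = [n=0]·(−½η^d|(D^η_B̃φ′)(b)|²) + Σ_{n′≦n̄, n+n′≧1}(1.8)_{n,n′} + (1.9)_n + Σ_{n′≦n̄, n+n′ even, ≧2}(1.10)_{n,n′} + (1.11)_n`,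
each vertex taken with `S = {b}`. [cite: Balaban1983Higgs3, (1.8)–(1.11) p.413] -/
theorem taylorCoeff_kinBond (nbar n : ℕ) (b : PBond P k) :
    ((n.factorial : ℝ)⁻¹) * iteratedDeriv n (kinBond C g B A1 At φ b) 0
      = (if n = 0 then -(1 / 2 : ℝ) * P.mesh k ^ P.d * ‖covDeriv C B φ b‖ ^ 2 else 0)
        + (∑ n' ∈ (Finset.range (nbar + 1)).filter (fun n' => 1 ≤ n + n'), vertex18 C g B A1 At φ n n' {b})
        + vertex19 C g B A1 At φ nbar n {b}
        + (∑ n' ∈ (Finset.range (nbar + 1)).filter (fun n' => Even (n + n') ∧ 2 ≤ n + n'),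
            vertex110 C g A1 At φ n n' {b})
        + vertex111 C g A1 At φ nbar n {b} := by
  have hη : P.mesh k ≠ 0 := (P.mesh_pos k).ne'
  -- the per-`(n, n′)` summands for ALL `(n, n′)`, written at the bond `b`
  set T18 : ℕ → ℝ := fun m => C.e ^ (n + m) * ((-1 : ℝ) ^ (n + m) * (P.mesh k ^ (n + m) * (P.mesh k)⁻¹)
      / ((n.factorial : ℝ) * m.factorial))
    * (P.mesh k ^ P.d * leg18 C B φ (C.q ^ (n + m)) b * (g b.src * A1 b) ^ n * At b ^ m) with hT18
  set T110 : ℕ → ℝ := fun m => C.e ^ (n + m) * ((-1 : ℝ) ^ (n + m) * (P.mesh k ^ (n + m) * (P.mesh k)⁻¹ * (P.mesh k)⁻¹)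
      / ((n.factorial : ℝ) * m.factorial))
    * (P.mesh k ^ P.d * leg110 φ (C.q ^ (n + m)) b * (g b.src * A1 b) ^ n * At b ^ m) with hT110
  -- (i) the derivative in closed form, expanded by (I.3.14); every piece written as `(1/n!)·(…)`
  have h0 : (0 : ℝ) • opY C g A1 b = 0 := zero_smul ℝ (opY C g A1 b)
  have s18 : ∑ m ∈ Finset.range (nbar + 1), T18 m
      = ((n.factorial : ℝ)⁻¹) * (P.mesh k ^ P.d * (P.mesh k)⁻¹
          * ∑ m ∈ Finset.range (nbar + 1),
              (((m.factorial : ℝ)⁻¹)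
                  * ((-(P.mesh k * C.e * (g b.src * A1 b))) ^ n * (-(P.mesh k * C.e * At b)) ^ m))
                * ⟪covDeriv C B φ b, (C.q ^ (n + m)) (φ b.src)⟫_ℝ) := by
    rw [Finset.mul_sum, Finset.mul_sum]
    refine Finset.sum_congr rfl fun m _ => ?_
    simp only [hT18]
    unfold leg18
    field_simp
    ring
  have s110 : ∑ m ∈ Finset.range (nbar + 1), T110 m
      = ((n.factorial : ℝ)⁻¹) * (P.mesh k ^ P.d * (P.mesh k)⁻¹ ^ 2
          * ∑ m ∈ Finset.range (nbar + 1),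
              (((m.factorial : ℝ)⁻¹)
                  * ((-(P.mesh k * C.e * (g b.src * A1 b))) ^ n * (-(P.mesh k * C.e * At b)) ^ m))
                * ⟪φ b.src, (C.q ^ (n + m)) (φ b.src)⟫_ℝ) := by
    rw [Finset.mul_sum, Finset.mul_sum]
    refine Finset.sum_congr rfl fun m _ => ?_
    simp only [hT110]
    unfold leg110
    field_simp
    ring
  have s19 : vertex19 C g B A1 At φ nbar n {b}
      = ((n.factorial : ℝ)⁻¹) * (P.mesh k ^ P.d * (P.mesh k)⁻¹
          * (((((nbar + 1).factorial : ℝ)⁻¹)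
              * ((-(P.mesh k * C.e * (g b.src * A1 b))) ^ n * (-(P.mesh k * C.e * At b)) ^ (nbar + 1)))
            * ⟪covDeriv C B φ b, (C.q ^ (n + nbar + 1) * remTensor C nbar At b) (φ b.src)⟫_ℝ)) := by
    unfold vertex19 leg18
    rw [Finset.sum_singleton]
    field_simp
    ring
  have s111 : vertex111 C g A1 At φ nbar n {b}
      = ((n.factorial : ℝ)⁻¹) * (P.mesh k ^ P.d * (P.mesh k)⁻¹ ^ 2
          * (((((nbar + 1).factorial : ℝ)⁻¹)
              * ((-(P.mesh k * C.e * (g b.src * A1 b))) ^ n * (-(P.mesh k * C.e * At b)) ^ (nbar + 1)))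
            * ⟪φ b.src, (C.q ^ (n + nbar + 1) * remTensor C nbar At b) (φ b.src)⟫_ℝ)) := by
    unfold vertex111 leg110
    rw [Finset.sum_singleton, ← Nat.cast_add, zpow_sub_one_nat hη]
    field_simp
    ring
  have hD : ((n.factorial : ℝ)⁻¹) * iteratedDeriv n (kinBond C g B A1 At φ b) 0
      = ((n.factorial : ℝ)⁻¹) * (if n = 0 then kinConst C B φ b else 0)
        + ((∑ m ∈ Finset.range (nbar + 1), T18 m) + ∑ m ∈ Finset.range (nbar + 1), T110 m)
        + (vertex19 C g B A1 At φ nbar n {b} + vertex111 C g A1 At φ nbar n {b}) := by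
    rw [s18, s110, s19, s111, iteratedDeriv_kinBond]
    unfold kinDeriv
    rw [h0, exp_zero, one_mul, inner_opY_pow_mul_exp_opZ C g A1 At nbar n b,
      inner_opY_pow_mul_exp_opZ C g A1 At nbar n b]
    ring
  -- (ii) regroup the `(n, n′)` sums
  have h18 : ∑ m ∈ Finset.range (nbar + 1), T18 m
      = (if n = 0 then T18 0 else 0)
        + ∑ n' ∈ (Finset.range (nbar + 1)).filter (fun n' => 1 ≤ n + n'), vertex18 C g B A1 At φ n n' {b} := by
    rw [sum_range_split_pos T18 n nbar]
    congr 1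
    refine Finset.sum_congr rfl fun m _ => ?_
    rw [hT18]
    unfold vertex18
    rw [Finset.sum_singleton, ← Nat.cast_add, zpow_sub_one_nat hη]
  have h110 : ∑ m ∈ Finset.range (nbar + 1), T110 m
      = (if n = 0 then T110 0 else 0)
        + ∑ n' ∈ (Finset.range (nbar + 1)).filter (fun n' => Even (n + n') ∧ 2 ≤ n + n'),
            vertex110 C g A1 At φ n n' {b} := by
    rw [sum_range_split_even T110 n nbar (fun m hm => by
      rw [hT110]
      simp only [leg110_qpow_of_odd C hm, mul_zero, zero_mul])]
    congr 1
    refine Finset.sum_congr rfl fun m hm => ?_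
    rw [Finset.mem_filter] at hm
    simp only [hT110]
    unfold vertex110
    rw [Finset.sum_singleton, ← Nat.cast_add, zpow_sub_two_nat hη, Even.neg_one_pow hm.2.1, one_mul]
  -- (iii) the `n = n′ = 0` terms against the constant
  have h00 : ((n.factorial : ℝ)⁻¹) * (if n = 0 then kinConst C B φ b else 0) + (if n = 0 then T18 0 else 0)
        + (if n = 0 then T110 0 else 0)
      = (if n = 0 then -(1 / 2 : ℝ) * P.mesh k ^ P.d * ‖covDeriv C B φ b‖ ^ 2 else 0) := by
    split_ifs with h
    · subst h
      simp only [hT18, hT110]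
      unfold kinConst leg18 leg110
      simp only [add_zero, pow_zero, Nat.factorial_zero, Nat.cast_one, inv_one, mul_one, one_mul, div_one]
      rw [show (1 : Op N) (φ b.src) = φ b.src from rfl, real_inner_self_eq_norm_sq]
      ring
    · simp
  rw [hD, h18, h110, ← h00]
  ring

/-- The bonds lying inside a region `Ω` (both endpoints in `Ω`; the Neumann form of (I.2.17) keeps exactly these). [cite: Balaban1982Higgs1, (2.17) p.610] -/
def insideBonds (Ω : Finset (Site P k)) : Finset (PBond P k) := Finset.univ.filter (Inside Ω)

/-- `−½⟨φ′, (−Δ^{η,N}_{A,Ω})φ′⟩ = Σ_{b⊂Ω} (−½η^d|(D^η_Aφ′)(b)|²)` (`HiggsCovariancePos.siteInner_covLaplacianN`). [cite: Balaban1982Higgs1, (2.17) p.610] -/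
theorem kineticForm_eq_sum_bonds (Ω : Finset (Site P k)) (A : VecField P k) :
    -(1 / 2 : ℝ) * siteInner φ (covLaplacianN C Ω A φ)
      = ∑ b ∈ insideBonds Ω, -(1 / 2 : ℝ) * P.mesh k ^ P.d * ‖covDeriv C A φ b‖ ^ 2 := by
  rw [siteInner_covLaplacianN, insideBonds, Finset.sum_filter, Finset.mul_sum]
  refine Finset.sum_congr rfl fun b _ => ?_
  split_ifs
  · rw [real_inner_self_eq_norm_sq]; ring
  · simp

/-- The kinetic term at `B̃ + e′g_kA′ + Ã` is the sum of the bond densities. [cite: Balaban1983Higgs3, (1.4) p.412] -/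
theorem kineticForm_eq_sum_kinBond (Ω : Finset (Site P k)) (s : ℝ) :
    -(1 / 2 : ℝ) * siteInner φ (covLaplacianN C Ω (B + (s • gmul g A1 + At)) φ)
      = ∑ b ∈ insideBonds Ω, kinBond C g B A1 At φ b s :=
  kineticForm_eq_sum_bonds C φ Ω _

/-- Iterated derivatives of a finite sum of the bond densities. [folklore] -/
private theorem iteratedDeriv_sum_kinBond (S : Finset (PBond P k)) (n : ℕ) :
    iteratedDeriv n (fun s => ∑ b ∈ S, kinBond C g B A1 At φ b s)
      = fun s => ∑ b ∈ S, kinDeriv C g B A1 At φ b n s := by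
  have hf : ∀ m s, HasDerivAt (fun s => ∑ b ∈ S, kinDeriv C g B A1 At φ b m s)
      (∑ b ∈ S, kinDeriv C g B A1 At φ b (m + 1) s) s :=
    fun m s => HasDerivAt.fun_sum fun b _ => hasDerivAt_kinDeriv C g B A1 At φ b m s
  have h := iteratedDeriv_eq_of_hasDerivAt_succ (fun m s => ∑ b ∈ S, kinDeriv C g B A1 At φ b m s) hf n
  simp only [kinBond_eq_kinDeriv_zero]
  exact h

/-- **p. 413: *"These vertices come from an expansion of the original lattice action"* — THE KINETIC TERM ON A REGION.**
For every region `Ω` of the `η`-lattice, every order `n`, every `n̄` and all fields: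
`(1/n!)·∂ⁿ_{e′}|_{e′=0}(−½⟨φ′,(−Δ^{η,N}_{B̃+e′g_kA′+Ã,Ω})φ′⟩)
 = [n=0]·(−½⟨φ′,(−Δ^{η,N}_{B̃,Ω})φ′⟩) + Σ_{n′≦n̄, n+n′≧1}(1.8)_{n,n′} + (1.9)_n + Σ_{n′≦n̄, n+n′ even, ≧2}(1.10)_{n,n′} + (1.11)_n`,
the vertices summed over the bonds inside `Ω` (print's `Σ_b`). [cite: Balaban1983Higgs3, (1.8)–(1.11) p.413] -/
theorem taylorCoeff_kineticForm (Ω : Finset (Site P k)) (nbar n : ℕ) :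
    ((n.factorial : ℝ)⁻¹)
        * iteratedDeriv n
          (fun s : ℝ => -(1 / 2 : ℝ) * siteInner φ (covLaplacianN C Ω (B + (s • gmul g A1 + At)) φ)) 0
      = (if n = 0 then -(1 / 2 : ℝ) * siteInner φ (covLaplacianN C Ω B φ) else 0)
        + (∑ n' ∈ (Finset.range (nbar + 1)).filter (fun n' => 1 ≤ n + n'),
            vertex18 C g B A1 At φ n n' (insideBonds Ω))
        + vertex19 C g B A1 At φ nbar n (insideBonds Ω)
        + (∑ n' ∈ (Finset.range (nbar + 1)).filter (fun n' => Even (n + n') ∧ 2 ≤ n + n'),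
            vertex110 C g A1 At φ n n' (insideBonds Ω))
        + vertex111 C g A1 At φ nbar n (insideBonds Ω) := by
  have hfun : (fun s : ℝ => -(1 / 2 : ℝ) * siteInner φ (covLaplacianN C Ω (B + (s • gmul g A1 + At)) φ))
      = fun s : ℝ => ∑ b ∈ insideBonds Ω, kinBond C g B A1 At φ b s := by
    funext s; exact kineticForm_eq_sum_kinBond C g B A1 At φ Ω s
  rw [hfun, iteratedDeriv_sum_kinBond]
  beta_reduce
  rw [Finset.mul_sum]
  have hb : ∀ b ∈ insideBonds Ω, ((n.factorial : ℝ)⁻¹) * kinDeriv C g B A1 At φ b n 0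
      = (if n = 0 then -(1 / 2 : ℝ) * P.mesh k ^ P.d * ‖covDeriv C B φ b‖ ^ 2 else 0)
        + (∑ n' ∈ (Finset.range (nbar + 1)).filter (fun n' => 1 ≤ n + n'), vertex18 C g B A1 At φ n n' {b})
        + vertex19 C g B A1 At φ nbar n {b}
        + (∑ n' ∈ (Finset.range (nbar + 1)).filter (fun n' => Even (n + n') ∧ 2 ≤ n + n'),
            vertex110 C g A1 At φ n n' {b})
        + vertex111 C g A1 At φ nbar n {b} := by
    intro b _
    rw [← iteratedDeriv_kinBond]
    exact taylorCoeff_kinBond C g B A1 At φ nbar n b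
  rw [Finset.sum_congr rfl hb]
  simp only [Finset.sum_add_distrib]
  rw [Finset.sum_comm, vertex19_eq_sum, vertex111_eq_sum]
  congr 1
  congr 1
  congr 1
  · congr 1
    · split_ifs
      · rw [kineticForm_eq_sum_bonds]
      · simp
    · exact Finset.sum_congr rfl fun n' _ => (vertex18_eq_sum C g B A1 At φ n n' _).symm
  · rw [Finset.sum_comm]
    exact Finset.sum_congr rfl fun n' _ => (vertex110_eq_sum C g A1 At φ n n' _).symm

/-- At `Ã = 0` the vertices with `n′ ≧ 1` and the R-vertices vanish. [cite: Balaban1983Higgs3, p.414 (after (1.15))] -/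
theorem vertex18_noSmallField {n' : ℕ} (hn' : 1 ≤ n') (n : ℕ) (S : Finset (PBond P k)) :
    vertex18 C g B A1 0 φ n n' S = 0 := by
  unfold vertex18
  rw [Finset.sum_eq_zero fun b _ => ?_, mul_zero]
  rw [Pi.zero_apply, zero_pow (by omega), mul_zero]

/-- At `Ã = 0` the R-vertex (1.9) vanishes. [cite: Balaban1983Higgs3, p.414 (after (1.15))] -/
theorem vertex19_noSmallField (nbar n : ℕ) (S : Finset (PBond P k)) : vertex19 C g B A1 0 φ nbar n S = 0 := by
  unfold vertex19
  rw [Finset.sum_eq_zero fun b _ => ?_, mul_zero]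
  rw [Pi.zero_apply, zero_pow (Nat.succ_ne_zero nbar), mul_zero]

/-- At `Ã = 0` the vertices (1.10) with `n′ ≧ 1` vanish. [cite: Balaban1983Higgs3, p.414 (after (1.15))] -/
theorem vertex110_noSmallField {n' : ℕ} (hn' : 1 ≤ n') (n : ℕ) (S : Finset (PBond P k)) :
    vertex110 C g A1 0 φ n n' S = 0 := by
  unfold vertex110
  rw [Finset.sum_eq_zero fun b _ => ?_, mul_zero]
  rw [Pi.zero_apply, zero_pow (by omega), mul_zero]

/-- At `Ã = 0` the R-vertex (1.11) vanishes. [cite: Balaban1983Higgs3, p.414 (after (1.15))] -/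
theorem vertex111_noSmallField (nbar n : ℕ) (S : Finset (PBond P k)) : vertex111 C g A1 0 φ nbar n S = 0 := by
  unfold vertex111
  rw [Finset.sum_eq_zero fun b _ => ?_, mul_zero]
  rw [Pi.zero_apply, zero_pow (Nat.succ_ne_zero nbar), mul_zero]

/-- **p. 414: *"the vertices of (1.5) are given by (1.6)–(1.8), (1.10), … with n′ = 0"*** — with no small field
(`Ã = 0`) the `e′`-expansion of the kinetic term is exact and polynomial-free of remainders: for `n ≧ 1`,
`(1/n!)·∂ⁿ_{e′}|₀(−½⟨φ′,(−Δ^{η,N}_{B̃+e′g_kA′,Ω})φ′⟩) = (1.8)_{n,0} + [n even]·(1.10)_{n,0}`.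
[cite: Balaban1983Higgs3, p.414 (after (1.15))] -/
theorem taylorCoeff_kineticForm_noSmallField (Ω : Finset (Site P k)) {n : ℕ} (hn : 1 ≤ n) :
    ((n.factorial : ℝ)⁻¹)
        * iteratedDeriv n (fun s : ℝ => -(1 / 2 : ℝ) * siteInner φ (covLaplacianN C Ω (B + s • gmul g A1) φ)) 0
      = vertex18 C g B A1 0 φ n 0 (insideBonds Ω)
        + (if Even n then vertex110 C g A1 0 φ n 0 (insideBonds Ω) else 0) := by
  have h := taylorCoeff_kineticForm C g B A1 (0 : VecField P k) φ Ω 0 n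
  simp only [add_zero] at h
  rw [h, if_neg (by omega), vertex19_noSmallField, vertex111_noSmallField, zero_add, add_zero, add_zero]
  have hf1 : (Finset.range (0 + 1)).filter (fun n' => 1 ≤ n + n') = {0} := by
    ext m
    simp only [Finset.mem_filter, Finset.mem_range, Finset.mem_singleton]
    omega
  rw [hf1, Finset.sum_singleton]
  congr 1
  by_cases he : Even n
  · have hf2 : (Finset.range (0 + 1)).filter (fun n' => Even (n + n') ∧ 2 ≤ n + n') = {0} := by
      ext m
      simp only [Finset.mem_filter, Finset.mem_range, Finset.mem_singleton]
      constructor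
      · rintro ⟨hm, -, -⟩
        omega
      · intro hm
        subst hm
        refine ⟨by omega, by simpa using he, ?_⟩
        obtain ⟨r, hr⟩ := he
        omega
    rw [hf2, Finset.sum_singleton, if_pos he]
  · have hf2 : (Finset.range (0 + 1)).filter (fun n' => Even (n + n') ∧ 2 ≤ n + n') = ∅ := by
      refine Finset.filter_eq_empty_iff.mpr ?_
      rintro m hm ⟨hev, -⟩
      rw [Finset.mem_range] at hm
      have h0 : m = 0 := by omega
      subst h0
      exact he (by simpa using hev)
    rw [hf2, Finset.sum_empty, if_neg he]

end Expansion

/-! ## §5. The typed (1.4): `B̃ = A^{(k)}`, `n′ = 0` (p. 414) -/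

section Data14

open Literature.MathematicalPhysics.QuantumFieldTheory.Balaban1983to89.B3Eq14AuxFunction

variable {K : ℕ} (D : Data14 P N K)

/-- The typer's `B3Eq14AuxFunction.siteMul` (level `0` of the (1.4) family) is `gmul`. [cite: Balaban1983Higgs3, (1.4) p.412] -/
theorem siteMul_eq_gmul (g : Site P 0 → ℝ) (A : VecField P 0) : siteMul g A = gmul g A := rfl

/-- **The exponent of the density of (1.4)**, term by term: kinetic term at `e′g_k𝒜 + A^{(k)}`, mass term, `λ′`·(1.6)
with `λ(L^kε)`, the counterterm vertex (1.7) with the TOTAL `δm²(e′, g_k, λ′, Ω₁, ·)`, and `−E₁`.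
[cite: Balaban1983Higgs3, (1.4)–(1.7) pp.412–413] -/
theorem log_density14_eq (Ak : VecField P 0) (e' lam' : ℝ) (A' : (j : Fin K) → VecField P j)
    (φ' : ScalarField P 0 N) :
    Real.log (D.density14 Ak e' lam' A' φ')
      = -(1 / 2 : ℝ) * siteInner φ' (covLaplacianN D.C D.Ω (D.extField Ak e' A') φ')
        - (1 / 2 : ℝ) * (D.m2 * D.ell ^ 2) * siteInner φ' φ'
        + lam' * vertex16 D.lamRun D.Ω₁ φ'
        + vertex17 (D.dm2 e' lam') D.ell D.Ω₁ φ'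
        - D.E1 e' lam' := by
  rw [Data14.density14_eq, Real.log_exp]
  have hsplit : siteInner φ' (D.scalarOp Ak e' A' φ')
      = siteInner φ' (covLaplacianN D.C D.Ω (D.extField Ak e' A') φ') + (D.m2 * D.ell ^ 2) * siteInner φ' φ' := by
    rw [Data14.scalarOp_eq]
    unfold siteInner
    rw [Finset.mul_sum, ← Finset.sum_add_distrib]
    refine Finset.sum_congr rfl fun x _ => ?_
    rw [LinearMap.add_apply, LinearMap.smul_apply, LinearMap.id_apply, Pi.add_apply, Pi.smul_apply, inner_add_right,
      real_inner_smul_right]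
    ring
  rw [hsplit]
  unfold vertex16 vertex17
  ring

/-- **p. 414 for the typed (1.4): *"the vertices of (1.5) are given by (1.6)–(1.8), (1.10), … with n′ = 0 and
B̃ = A^{(k)}"*** — the `e′`-Taylor coefficients at `e′ = 0` of the kinetic term of the exponent of (1.4)
(`B3Eq14AuxFunction.Data14.extField Ak e′ A′ = e′g_k𝒜 + A^{(k)}`, `𝒜 = fluctSum A′` the field *"A′"* of p. 414 with
covariance `G_k`) are the vertices (1.8)_{n,0} + [n even]·(1.10)_{n,0} at `B̃ = A^{(k)}`, `Ã = 0`, summed over the bonds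
inside `Ω`, for every `n ≧ 1`. [cite: Balaban1983Higgs3, p.414 (after (1.15)), (1.4)–(1.5) p.412] -/
theorem taylorCoeff_density14_kinetic (Ak : VecField P 0) (A' : (j : Fin K) → VecField P j) (φ' : ScalarField P 0 N)
    {n : ℕ} (hn : 1 ≤ n) :
    ((n.factorial : ℝ)⁻¹)
        * iteratedDeriv n (fun e' : ℝ => -(1 / 2 : ℝ) * siteInner φ' (covLaplacianN D.C D.Ω (D.extField Ak e' A') φ')) 0
      = vertex18 D.C D.g Ak (D.fluctSum A') 0 φ' n 0 (insideBonds D.Ω)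
        + (if Even n then vertex110 D.C D.g (D.fluctSum A') 0 φ' n 0 (insideBonds D.Ω) else 0) := by
  have hfun : (fun e' : ℝ => -(1 / 2 : ℝ) * siteInner φ' (covLaplacianN D.C D.Ω (D.extField Ak e' A') φ'))
      = fun s : ℝ => -(1 / 2 : ℝ) * siteInner φ' (covLaplacianN D.C D.Ω (Ak + s • gmul D.g (D.fluctSum A')) φ') := by
    funext s
    rw [Data14.extField_eq, siteMul_eq_gmul, add_comm]
  rw [hfun]
  exact taylorCoeff_kineticForm_noSmallField D.C D.g Ak (D.fluctSum A') φ' D.Ω hn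

end Data14

/-! ## §6. DATA BRIDGE to the token of record `B3Prop1.VertexKind` (v1.1, append-only; row owner's precision (i)) -/

section DataBridge

open Literature.MathematicalPhysics.QuantumFieldTheory.Balaban1983to89.B3Prop1 (VertexKind)

variable (C : ChargeData N)

/-- `D^η_B̃` is linear in the scalar field: `(D^η_B̃(cφ))(b) = c·(D^η_B̃φ)(b)` ((I.1.8)). [cite: Balaban1982Higgs1, (1.8) p.605] -/
theorem covDeriv_smul_apply (B : VecField P k) (c : ℝ) (φ : ScalarField P k N) (b : PBond P k) :
    covDeriv C B (c • φ) b = c • covDeriv C B φ b := by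
  simp only [covDeriv, Pi.smul_apply]
  rw [map_smul, ← smul_sub, smul_comm]

/-- The leg bracket of (1.8)/(1.9) is quadratic in `φ′` (two scalar legs). [cite: Balaban1983Higgs3, (1.8) p.413] -/
theorem leg18_smul (B : VecField P k) (c : ℝ) (φ : ScalarField P k N) (T : Op N) (b : PBond P k) :
    leg18 C B (c • φ) T b = c ^ 2 * leg18 C B φ T b := by
  unfold leg18
  rw [covDeriv_smul_apply, Pi.smul_apply, map_smul, real_inner_smul_left, real_inner_smul_right]
  ring

/-- The leg bracket of (1.10)/(1.11) is quadratic in `φ′`. [cite: Balaban1983Higgs3, (1.10) p.413] -/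
theorem leg110_smul (c : ℝ) (φ : ScalarField P k N) (T : Op N) (b : PBond P k) :
    leg110 (c • φ) T b = c ^ 2 * leg110 φ T b := by
  unfold leg110
  rw [Pi.smul_apply, map_smul, real_inner_smul_left, real_inner_smul_right]
  ring

/-- **Scalar legs = `VertexKind.scalarLegs`** (4 for (1.6)): (1.6) is homogeneous of degree `VertexKind.v16.scalarLegs` in `φ′`.
[cite: Balaban1983Higgs3, (1.6) p.413] -/
theorem vertex16_smul_field (lamRun c : ℝ) (Ω₁ : Finset (Site P k)) (φ : ScalarField P k N) :
    vertex16 lamRun Ω₁ (c • φ) = c ^ VertexKind.v16.scalarLegs * vertex16 lamRun Ω₁ φ := by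
  have h4 : ∀ x : Site P k, ‖(c • φ) x‖ ^ 4 = c ^ 4 * ‖φ x‖ ^ 4 := fun x => by
    rw [Pi.smul_apply, norm_smul, mul_pow, Real.norm_eq_abs, show (4 : ℕ) = 2 * 2 from rfl, pow_mul, sq_abs, ← pow_mul]
  unfold vertex16
  simp only [h4, VertexKind.scalarLegs]
  have hs : ∑ x ∈ Ω₁, P.mesh k ^ P.d * (c ^ 4 * ‖φ x‖ ^ 4) = c ^ 4 * ∑ x ∈ Ω₁, P.mesh k ^ P.d * ‖φ x‖ ^ 4 := by
    rw [Finset.mul_sum]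
    exact Finset.sum_congr rfl fun x _ => by ring
  rw [hs]
  ring

/-- (1.7) is homogeneous of degree `VertexKind.v17.scalarLegs = 2` in `φ′`. [cite: Balaban1983Higgs3, (1.7) p.413] -/
theorem vertex17_smul_field (dm2 : Site P k → ℝ) (ell c : ℝ) (Ω₁ : Finset (Site P k)) (φ : ScalarField P k N) :
    vertex17 dm2 ell Ω₁ (c • φ) = c ^ VertexKind.v17.scalarLegs * vertex17 dm2 ell Ω₁ φ := by
  have h2 : ∀ x : Site P k, ‖(c • φ) x‖ ^ 2 = c ^ 2 * ‖φ x‖ ^ 2 := fun x => by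
    rw [Pi.smul_apply, norm_smul, mul_pow, Real.norm_eq_abs, sq_abs]
  unfold vertex17
  simp only [h2, VertexKind.scalarLegs, Finset.mul_sum]
  refine Finset.sum_congr rfl fun x _ => ?_
  ring

/-- (1.8) is homogeneous of degree `(VertexKind.v18 n n′).scalarLegs = 2` in `φ′`. [cite: Balaban1983Higgs3, (1.8) p.413] -/
theorem vertex18_smul_field (g : Site P k → ℝ) (B A1 At : VecField P k) (c : ℝ) (φ : ScalarField P k N) (n n' : ℕ)
    (S : Finset (PBond P k)) :
    vertex18 C g B A1 At (c • φ) n n' S = c ^ (VertexKind.v18 n n').scalarLegs * vertex18 C g B A1 At φ n n' S := by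
  unfold vertex18
  simp only [leg18_smul, VertexKind.scalarLegs, Finset.mul_sum]
  refine Finset.sum_congr rfl fun b _ => ?_
  ring

/-- (1.9) is homogeneous of degree `(VertexKind.v19 n n̄).scalarLegs = 2` in `φ′`. [cite: Balaban1983Higgs3, (1.9) p.413] -/
theorem vertex19_smul_field (g : Site P k → ℝ) (B A1 At : VecField P k) (c : ℝ) (φ : ScalarField P k N) (nbar n : ℕ)
    (S : Finset (PBond P k)) :
    vertex19 C g B A1 At (c • φ) nbar n S = c ^ (VertexKind.v19 n nbar).scalarLegs * vertex19 C g B A1 At φ nbar n S := by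
  unfold vertex19
  simp only [leg18_smul, VertexKind.scalarLegs, Finset.mul_sum]
  refine Finset.sum_congr rfl fun b _ => ?_
  ring

/-- (1.10) is homogeneous of degree `(VertexKind.v110 n n′).scalarLegs = 2` in `φ′`. [cite: Balaban1983Higgs3, (1.10) p.413] -/
theorem vertex110_smul_field (g : Site P k → ℝ) (A1 At : VecField P k) (c : ℝ) (φ : ScalarField P k N) (n n' : ℕ)
    (S : Finset (PBond P k)) :
    vertex110 C g A1 At (c • φ) n n' S = c ^ (VertexKind.v110 n n').scalarLegs * vertex110 C g A1 At φ n n' S := by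
  unfold vertex110
  simp only [leg110_smul, VertexKind.scalarLegs, Finset.mul_sum]
  refine Finset.sum_congr rfl fun b _ => ?_
  ring

/-- (1.11) is homogeneous of degree `(VertexKind.v111 n n̄).scalarLegs = 2` in `φ′`. [cite: Balaban1983Higgs3, (1.11) p.413] -/
theorem vertex111_smul_field (g : Site P k → ℝ) (A1 At : VecField P k) (c : ℝ) (φ : ScalarField P k N) (nbar n : ℕ)
    (S : Finset (PBond P k)) :
    vertex111 C g A1 At (c • φ) nbar n S = c ^ (VertexKind.v111 n nbar).scalarLegs * vertex111 C g A1 At φ nbar n S := by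
  unfold vertex111
  simp only [leg110_smul, VertexKind.scalarLegs, Finset.mul_sum]
  refine Finset.sum_congr rfl fun b _ => ?_
  ring

/-- **A′-legs = `VertexKind.vectorLegs`**: (1.8) is homogeneous of degree `(VertexKind.v18 n n′).vectorLegs = n` in the
fluctuation field `A′` (p. 414: *"All the A′-legs are contracted"*). [cite: Balaban1983Higgs3, (1.8) p.413] -/
theorem vertex18_smul_fluct (g : Site P k → ℝ) (B A1 At : VecField P k) (c : ℝ) (φ : ScalarField P k N) (n n' : ℕ)
    (S : Finset (PBond P k)) :
    vertex18 C g B (c • A1) At φ n n' S = c ^ (VertexKind.v18 n n').vectorLegs * vertex18 C g B A1 At φ n n' S := by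
  unfold vertex18
  simp only [Pi.smul_apply, smul_eq_mul, VertexKind.vectorLegs, Finset.mul_sum]
  refine Finset.sum_congr rfl fun b _ => ?_
  rw [show g b.src * (c * A1 b) = c * (g b.src * A1 b) by ring, mul_pow]
  ring

/-- (1.9) is homogeneous of degree `(VertexKind.v19 n n̄).vectorLegs = n` in `A′`. [cite: Balaban1983Higgs3, (1.9) p.413] -/
theorem vertex19_smul_fluct (g : Site P k → ℝ) (B A1 At : VecField P k) (c : ℝ) (φ : ScalarField P k N) (nbar n : ℕ)
    (S : Finset (PBond P k)) :
    vertex19 C g B (c • A1) At φ nbar n S = c ^ (VertexKind.v19 n nbar).vectorLegs * vertex19 C g B A1 At φ nbar n S := by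
  unfold vertex19
  simp only [Pi.smul_apply, smul_eq_mul, VertexKind.vectorLegs, Finset.mul_sum]
  refine Finset.sum_congr rfl fun b _ => ?_
  rw [show g b.src * (c * A1 b) = c * (g b.src * A1 b) by ring, mul_pow]
  ring

/-- (1.10) is homogeneous of degree `(VertexKind.v110 n n′).vectorLegs = n` in `A′`. [cite: Balaban1983Higgs3, (1.10) p.413] -/
theorem vertex110_smul_fluct (g : Site P k → ℝ) (A1 At : VecField P k) (c : ℝ) (φ : ScalarField P k N) (n n' : ℕ)
    (S : Finset (PBond P k)) :
    vertex110 C g (c • A1) At φ n n' S = c ^ (VertexKind.v110 n n').vectorLegs * vertex110 C g A1 At φ n n' S := by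
  unfold vertex110
  simp only [Pi.smul_apply, smul_eq_mul, VertexKind.vectorLegs, Finset.mul_sum]
  refine Finset.sum_congr rfl fun b _ => ?_
  rw [show g b.src * (c * A1 b) = c * (g b.src * A1 b) by ring, mul_pow]
  ring

/-- (1.11) is homogeneous of degree `(VertexKind.v111 n n̄).vectorLegs = n` in `A′`. [cite: Balaban1983Higgs3, (1.11) p.413] -/
theorem vertex111_smul_fluct (g : Site P k → ℝ) (A1 At : VecField P k) (c : ℝ) (φ : ScalarField P k N) (nbar n : ℕ)
    (S : Finset (PBond P k)) :
    vertex111 C g (c • A1) At φ nbar n S = c ^ (VertexKind.v111 n nbar).vectorLegs * vertex111 C g A1 At φ nbar n S := by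
  unfold vertex111
  simp only [Pi.smul_apply, smul_eq_mul, VertexKind.vectorLegs, Finset.mul_sum]
  refine Finset.sum_congr rfl fun b _ => ?_
  rw [show g b.src * (c * A1 b) = c * (g b.src * A1 b) by ring, mul_pow]
  ring

/-- **Ã-legs = `VertexKind.extVectorLegs`** for the non-R vertices: (1.8) is homogeneous of degree
`(VertexKind.v18 n n′).extVectorLegs = n′` in the external field `Ã` (the R-vertices (1.9)/(1.11) are NOT homogeneous in `Ã`:
their remainder tensor `R_{n̄+1}(−ηqe(L^kε)Ã_b)` depends on `Ã`; their count `n̄ + 1` is the explicit power, print bounding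
`|R_{n̄+1}| ≦ 1` separately, p. 414). [cite: Balaban1983Higgs3, (1.8) p.413] -/
theorem vertex18_smul_ext (g : Site P k → ℝ) (B A1 At : VecField P k) (c : ℝ) (φ : ScalarField P k N) (n n' : ℕ)
    (S : Finset (PBond P k)) :
    vertex18 C g B A1 (c • At) φ n n' S = c ^ (VertexKind.v18 n n').extVectorLegs * vertex18 C g B A1 At φ n n' S := by
  unfold vertex18
  simp only [Pi.smul_apply, smul_eq_mul, mul_pow, VertexKind.extVectorLegs, Finset.mul_sum]
  refine Finset.sum_congr rfl fun b _ => ?_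
  ring

/-- (1.10) is homogeneous of degree `(VertexKind.v110 n n′).extVectorLegs = n′` in `Ã`. [cite: Balaban1983Higgs3, (1.10) p.413] -/
theorem vertex110_smul_ext (g : Site P k → ℝ) (A1 At : VecField P k) (c : ℝ) (φ : ScalarField P k N) (n n' : ℕ)
    (S : Finset (PBond P k)) :
    vertex110 C g A1 (c • At) φ n n' S = c ^ (VertexKind.v110 n n').extVectorLegs * vertex110 C g A1 At φ n n' S := by
  unfold vertex110
  simp only [Pi.smul_apply, smul_eq_mul, mul_pow, VertexKind.extVectorLegs, Finset.mul_sum]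
  refine Finset.sum_congr rfl fun b _ => ?_
  ring

/-- **Coupling order `d_v` and η-count = `VertexKind.dv` / `VertexKind.etaCount`** for (1.8): the explicit power of
`e(L^kε)` is `(VertexKind.v18 n n′).dv = n + n′` and, the factor `η^d` of the bond sum absorbed, the total η-power is
`(VertexKind.v18 n n′).etaCount d = d + n + n′ − 1` (p. 420 *"d_v(v) an order of the coupling constant e"*; p. 422: each η has
dimension 1). [cite: Balaban1983Higgs3, (1.8) p.413] -/
theorem vertex18_eq_data (g : Site P k → ℝ) (B A1 At : VecField P k) (φ : ScalarField P k N) (n n' : ℕ)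
    (S : Finset (PBond P k)) :
    vertex18 C g B A1 At φ n n' S
      = C.e ^ (VertexKind.v18 n n').dv * ((-1 : ℝ) ^ (n + n') / ((n.factorial : ℝ) * n'.factorial))
        * ∑ b ∈ S, P.mesh k ^ ((VertexKind.v18 n n').etaCount P.d)
            * leg18 C B φ (C.q ^ (n + n')) b * (g b.src * A1 b) ^ n * At b ^ n' := by
  have hη : P.mesh k ≠ 0 := (Params.mesh_pos P k).ne'
  have hz : P.mesh k ^ ((VertexKind.v18 n n').etaCount P.d) = P.mesh k ^ ((n + n' : ℤ) - 1) * P.mesh k ^ P.d := by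
    rw [← zpow_natCast (P.mesh k) P.d, ← zpow_add₀ hη]
    congr 1
    simp only [VertexKind.etaCount]
    ring
  unfold vertex18
  simp only [hz, VertexKind.dv, Finset.mul_sum]
  refine Finset.sum_congr rfl fun b _ => ?_
  ring

/-- The same for (1.9): `dv = n + n̄ + 1`, `etaCount d = d + n + n̄`. [cite: Balaban1983Higgs3, (1.9) p.413] -/
theorem vertex19_eq_data (g : Site P k → ℝ) (B A1 At : VecField P k) (φ : ScalarField P k N) (nbar n : ℕ)
    (S : Finset (PBond P k)) :
    vertex19 C g B A1 At φ nbar n S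
      = C.e ^ (VertexKind.v19 n nbar).dv * ((-1 : ℝ) ^ (n + nbar + 1) / ((n.factorial : ℝ) * (nbar + 1).factorial))
        * ∑ b ∈ S, P.mesh k ^ ((VertexKind.v19 n nbar).etaCount P.d)
            * leg18 C B φ (C.q ^ (n + nbar + 1) * remTensor C nbar At b) b * (g b.src * A1 b) ^ n * At b ^ (nbar + 1) := by
  have hz : P.mesh k ^ ((VertexKind.v19 n nbar).etaCount P.d) = P.mesh k ^ (n + nbar) * P.mesh k ^ P.d := by
    rw [← pow_add, ← zpow_natCast]
    congr 1
    simp only [VertexKind.etaCount]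
    push_cast
    ring
  unfold vertex19
  simp only [hz, VertexKind.dv, Finset.mul_sum]
  refine Finset.sum_congr rfl fun b _ => ?_
  ring

/-- The same for (1.10): `dv = n + n′`, `etaCount d = d + n + n′ − 2`. [cite: Balaban1983Higgs3, (1.10) p.413] -/
theorem vertex110_eq_data (g : Site P k → ℝ) (A1 At : VecField P k) (φ : ScalarField P k N) (n n' : ℕ)
    (S : Finset (PBond P k)) :
    vertex110 C g A1 At φ n n' S
      = C.e ^ (VertexKind.v110 n n').dv * (1 / ((n.factorial : ℝ) * n'.factorial))
        * ∑ b ∈ S, P.mesh k ^ ((VertexKind.v110 n n').etaCount P.d)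
            * leg110 φ (C.q ^ (n + n')) b * (g b.src * A1 b) ^ n * At b ^ n' := by
  have hη : P.mesh k ≠ 0 := (Params.mesh_pos P k).ne'
  have hz : P.mesh k ^ ((VertexKind.v110 n n').etaCount P.d) = P.mesh k ^ ((n + n' : ℤ) - 2) * P.mesh k ^ P.d := by
    rw [← zpow_natCast (P.mesh k) P.d, ← zpow_add₀ hη]
    congr 1
    simp only [VertexKind.etaCount]
    ring
  unfold vertex110
  simp only [hz, VertexKind.dv, Finset.mul_sum]
  refine Finset.sum_congr rfl fun b _ => ?_
  ring

/-- The same for (1.11): `dv = n + n̄ + 1`, `etaCount d = d + n + n̄ − 1`. [cite: Balaban1983Higgs3, (1.11) p.413] -/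
theorem vertex111_eq_data (g : Site P k → ℝ) (A1 At : VecField P k) (φ : ScalarField P k N) (nbar n : ℕ)
    (S : Finset (PBond P k)) :
    vertex111 C g A1 At φ nbar n S
      = C.e ^ (VertexKind.v111 n nbar).dv * ((-1 : ℝ) ^ (n + nbar + 1) / ((n.factorial : ℝ) * (nbar + 1).factorial))
        * ∑ b ∈ S, P.mesh k ^ ((VertexKind.v111 n nbar).etaCount P.d)
            * leg110 φ (C.q ^ (n + nbar + 1) * remTensor C nbar At b) b * (g b.src * A1 b) ^ n * At b ^ (nbar + 1) := by
  have hη : P.mesh k ≠ 0 := (Params.mesh_pos P k).ne'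
  have hz : P.mesh k ^ ((VertexKind.v111 n nbar).etaCount P.d) = P.mesh k ^ ((n + nbar : ℤ) - 1) * P.mesh k ^ P.d := by
    rw [← zpow_natCast (P.mesh k) P.d, ← zpow_add₀ hη]
    congr 1
    simp only [VertexKind.etaCount]
    ring
  unfold vertex111
  simp only [hz, VertexKind.dv, Finset.mul_sum]
  refine Finset.sum_congr rfl fun b _ => ?_
  ring

/-- (1.6): `λ`-order `VertexKind.v16.ds = 1`, η-count `etaCount d = d`. [cite: Balaban1983Higgs3, (1.6) p.413] -/
theorem vertex16_eq_data (lamRun : ℝ) (Ω₁ : Finset (Site P k)) (φ : ScalarField P k N) :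
    vertex16 lamRun Ω₁ φ = -(lamRun ^ VertexKind.v16.ds * ∑ x ∈ Ω₁, P.mesh k ^ (VertexKind.v16.etaCount P.d) * ‖φ x‖ ^ 4) := by
  unfold vertex16
  simp only [VertexKind.ds, VertexKind.etaCount, pow_one, zpow_natCast]

/-- **Print's side conditions = the token's `VertexKind.Admissible` = the index ranges of the expansion theorem.** For
`n ≦ n̄` and `n′ ≦ n̄` (the range of `taylorCoeff_kinBond`'s sums): (1.8)_{n,n′} is admissible iff `n + n′ ≧ 1`.
[cite: Balaban1983Higgs3, (1.8) p.413] -/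
theorem admissible18_iff {nbar n n' : ℕ} (hn : n ≤ nbar) (hn' : n' ∈ Finset.range (nbar + 1)) :
    (VertexKind.v18 n n').Admissible nbar ↔ 1 ≤ n + n' := by
  rw [Finset.mem_range] at hn'
  simp only [VertexKind.Admissible]
  omega

/-- (1.10)_{n,n′} (`n, n′ ≦ n̄`) is admissible iff `n + n′` is even and `≧ 2` — the filter of `taylorCoeff_kinBond`.
[cite: Balaban1983Higgs3, (1.10) p.413] -/
theorem admissible110_iff {nbar n n' : ℕ} (hn : n ≤ nbar) (hn' : n' ∈ Finset.range (nbar + 1)) :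
    (VertexKind.v110 n n').Admissible nbar ↔ Even (n + n') ∧ 2 ≤ n + n' := by
  rw [Finset.mem_range] at hn'
  simp only [VertexKind.Admissible]
  constructor
  · rintro ⟨h1, -, -, h2⟩
    exact ⟨h1, h2⟩
  · rintro ⟨h1, h2⟩
    exact ⟨h1, hn, by omega, h2⟩

/-- The R-vertices (1.9)_n and (1.11)_n of `taylorCoeff_kinBond` (remainder order `n̄`) are admissible for every `n ≦ n̄`.
[cite: Balaban1983Higgs3, (1.9) p.413] -/
theorem admissible19_111 {nbar n : ℕ} (hn : n ≤ nbar) :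
    (VertexKind.v19 n nbar).Admissible nbar ∧ (VertexKind.v111 n nbar).Admissible nbar := by
  simp only [VertexKind.Admissible]
  exact ⟨⟨trivial, hn⟩, ⟨trivial, hn⟩⟩

/-- One lattice differentiation in (1.8)/(1.9) (`VertexKind.diffCount = 1`: the leg `(D^η_B̃φ′)(b)` of `leg18`), none in
(1.10)/(1.11) (`leg110`); definitional. [cite: Balaban1983Higgs3, (1.8)–(1.11) p.413] -/
theorem diffCount_catalogue (n n' nbar : ℕ) :
    (VertexKind.v18 n n').diffCount = 1 ∧ (VertexKind.v19 n nbar).diffCount = 1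
      ∧ (VertexKind.v110 n n').diffCount = 0 ∧ (VertexKind.v111 n nbar).diffCount = 0 := by
  simp [VertexKind.diffCount]

end DataBridge

/-! ## §7. Localization of the vertices, p. 420 (v1.2, append-only) -/

section Localization

open Literature.MathematicalPhysics.QuantumFieldTheory.Balaban1983to89.HiggsAveraging (blockK blockIter mem_blockK)
open Literature.MathematicalPhysics.QuantumFieldTheory.Balaban1983to89.B3Eq14AuxFunction (region mem_region)

variable (C : ChargeData N)

/-- A sum over the region `B^k(Λ)` of the `η`-lattice is the sum over the unit cubes `B^k(y)`, `y ∈ Λ` (p. 420: *"representing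
Ω₁ as a sum of unit cubes of the η-lattice"*). [cite: Balaban1983Higgs3, p.420] -/
theorem sum_region_eq_sum_blocks {M : Type*} [AddCommMonoid M] (K : ℕ) (Λ : Finset (Site P K)) (f : Site P 0 → M) :
    ∑ x ∈ region K Λ, f x = ∑ y ∈ Λ, ∑ x ∈ blockK K y, f x := by
  rw [← Finset.sum_fiberwise_of_maps_to (s := region K Λ) (t := Λ) (g := blockIter K) (f := f)
    fun x hx => (mem_region K Λ x).mp hx]
  refine Finset.sum_congr rfl fun y hy => Finset.sum_congr ?_ fun _ _ => rfl
  ext x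
  rw [Finset.mem_filter, mem_region, mem_blockK]
  constructor
  · rintro ⟨-, h⟩
    exact h
  · intro h
    exact ⟨h ▸ hy, h⟩

/-- **p. 420: *"For the vertices (1.6) and (1.7) we localize simply by representing Ω₁ as a sum of unit cubes of the
η-lattice"*** — (1.6) over `Ω₁ = B^k(Λ)` is the sum of the vertices (1.6) over the unit cubes `B^k(y)`, `y ∈ Λ`.
[cite: Balaban1983Higgs3, p.420] -/
theorem vertex16_region (lamRun : ℝ) (K : ℕ) (Λ : Finset (Site P K)) (φ : ScalarField P 0 N) :
    vertex16 lamRun (region K Λ) φ = ∑ y ∈ Λ, vertex16 lamRun (blockK K y) φ := by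
  unfold vertex16
  rw [sum_region_eq_sum_blocks, Finset.mul_sum, ← Finset.sum_neg_distrib]

/-- The same for (1.7). [cite: Balaban1983Higgs3, p.420] -/
theorem vertex17_region (dm2 : Site P 0 → ℝ) (ell : ℝ) (K : ℕ) (Λ : Finset (Site P K)) (φ : ScalarField P 0 N) :
    vertex17 dm2 ell (region K Λ) φ = ∑ y ∈ Λ, vertex17 dm2 ell (blockK K y) φ := by
  unfold vertex17
  rw [sum_region_eq_sum_blocks, Finset.mul_sum]

/-- (1.6) is additive over disjoint pieces of `Ω₁` (localization by any partition into cubes). [cite: Balaban1983Higgs3, p.420] -/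
theorem vertex16_union (lamRun : ℝ) {Ω Ω' : Finset (Site P k)} (h : Disjoint Ω Ω') (φ : ScalarField P k N) :
    vertex16 lamRun (Ω ∪ Ω') φ = vertex16 lamRun Ω φ + vertex16 lamRun Ω' φ := by
  unfold vertex16
  rw [Finset.sum_union h]
  ring

/-- (1.7) is additive over disjoint pieces of `Ω₁`. [cite: Balaban1983Higgs3, p.420] -/
theorem vertex17_union (dm2 : Site P k → ℝ) (ell : ℝ) {Ω Ω' : Finset (Site P k)} (h : Disjoint Ω Ω')
    (φ : ScalarField P k N) :
    vertex17 dm2 ell (Ω ∪ Ω') φ = vertex17 dm2 ell Ω φ + vertex17 dm2 ell Ω' φ := by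
  unfold vertex17
  rw [Finset.sum_union h]
  ring

/-- **p. 420: *"For the remaining vertices we localize …"*** — the bond vertices (1.8)–(1.11) are additive over disjoint
pieces of their bond set (the sharp localization; print smooths it with a partition of unity whose members are supported
in cubes of side 2). [cite: Balaban1983Higgs3, p.420] -/
theorem vertex18_union [DecidableEq (PBond P k)] (g : Site P k → ℝ) (B A1 At : VecField P k) (φ : ScalarField P k N) (n n' : ℕ)
    {S S' : Finset (PBond P k)} (h : Disjoint S S') :
    vertex18 C g B A1 At φ n n' (S ∪ S') = vertex18 C g B A1 At φ n n' S + vertex18 C g B A1 At φ n n' S' := by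
  unfold vertex18
  rw [Finset.sum_union h]
  ring

/-- The same for (1.9). [cite: Balaban1983Higgs3, p.420] -/
theorem vertex19_union [DecidableEq (PBond P k)] (g : Site P k → ℝ) (B A1 At : VecField P k) (φ : ScalarField P k N) (nbar n : ℕ)
    {S S' : Finset (PBond P k)} (h : Disjoint S S') :
    vertex19 C g B A1 At φ nbar n (S ∪ S') = vertex19 C g B A1 At φ nbar n S + vertex19 C g B A1 At φ nbar n S' := by
  unfold vertex19
  rw [Finset.sum_union h]
  ring

/-- The same for (1.10). [cite: Balaban1983Higgs3, p.420] -/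
theorem vertex110_union [DecidableEq (PBond P k)] (g : Site P k → ℝ) (A1 At : VecField P k) (φ : ScalarField P k N) (n n' : ℕ)
    {S S' : Finset (PBond P k)} (h : Disjoint S S') :
    vertex110 C g A1 At φ n n' (S ∪ S') = vertex110 C g A1 At φ n n' S + vertex110 C g A1 At φ n n' S' := by
  unfold vertex110
  rw [Finset.sum_union h]
  ring

/-- The same for (1.11). [cite: Balaban1983Higgs3, p.420] -/
theorem vertex111_union [DecidableEq (PBond P k)] (g : Site P k → ℝ) (A1 At : VecField P k) (φ : ScalarField P k N) (nbar n : ℕ)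
    {S S' : Finset (PBond P k)} (h : Disjoint S S') :
    vertex111 C g A1 At φ nbar n (S ∪ S') = vertex111 C g A1 At φ nbar n S + vertex111 C g A1 At φ nbar n S' := by
  unfold vertex111
  rw [Finset.sum_union h]
  ring

end Localization

end

end Literature.MathematicalPhysics.QuantumFieldTheory.Balaban1983to89.B3Eq18VertexExpansion
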